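import Summits.RiemannHypothesis.RiemannHypothesis.Theorems.TiltedLandingLaw421R3LandingDoor
import Summits.RiemannHypothesis.RiemannHypothesis.Theorems.TiltedLandingLaw421R3RealCritClose
import Summits.RiemannHypothesis.RiemannHypothesis.Theses.EarlyAppointments

/-! # LENS-1 sketch (rh33346-lens-1-g0) — REAL-LINE SIGN ⁄ VIRTUAL-ROOT lens on the SUCC law `RhW08.AntiEscapeSplit7.DoorAvailLawQ`

Ideation seat; nothing here is proposed to the tree; v3: the file is SORRY-FREE.  §1–§2 first lemmas of the two crux ideas filed on
`stmt-RiemannHypothesis-33346`; §3 v7 ∨ J2 composition; §4 door N♯ (`succ_of_newtonNumbersSharp`: Newton door with the regime clause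
`1 < ‖K‖·Im v` and the scalar slack N5 replaced by ONE frame-free Jensen-disc clause); §5 the same under the law OF RECORD v8
(`RhW08.LandingDoor.DoorAvailLawQ8`): v9 := v8 ∨ J2 ∨ N♯ reaches the crux decl by name; §6 REGIME OBSERVABLES `coverIndex` (ι) and
`fieldStrength` (κ) with the typed boundaries (B1) Jensen margin ⟺ `ρ₀ ≤ κ ∧ 2ι ≤ ρ₀² − 2ρ₀κ`, (B2) `κ < ½ → 0 < ι` (weak field forces
cover), (B3) N♯'s region in `(ι, κ)` + separation + END, (B4) child height `y(κ² + ι − ½)/κ²` (landing curve `ι = ½ − κ²`); §7 door N♭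
(`succ_of_newtonNumbersChild`: N's band slack charged at the CHILD with its signed height; (B6) its height clause in coordinates) and
v10 := v8 ∨ J2 ∨ N♯ ∨ N♭ → crux by name; §8 (E1) `endSum_le_two_S2` (far zeros ⇒ END sum ≤ 2S₂) and PIECE F PROVED
`newtonNumbersSharp_of_far` (un-covered with margin ∧ far ∧ light ⇒ N♯); §9 PIECE R modulo the typed SIGN IDENTITY (S1) `CoverIndexPairSum`:
`exists_cover_of_coverIndex_pos` (R1), `pairTerm_le_inv_norm` (R2), `coverIndex_mul_dist_le` (R3: `2ι·d₁ ≤ y·#S`) — proved.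
The two ideas:

* §1 `two-circle-pinned-count` — SOCKET `ClusterNumbersJ2` (pinned on an OUTER real-centred disc `D̄(a,ρ)`, `ρ ≤ Hs`;
  certified — count, depth, field variation — on an INNER real-centred circle `‖z − a'‖ = ρ'` inside it) and its door
  `succ_of_clusterNumbersJ2`, PROVED here by name from `RhW08.ClusterQM.tiltClusterLawQB_of_realBound` (no sorry).
* §2 `signed-jensen-floor` — the SIGNED Jensen potential: pair term positive iff `v` is strictly inside the pair's Jensen disc
  (`pairField_im_pos_iff`, proved), real zeros push inward (`realField_im_neg`), the Newton child of `v` lies in `v`'s own closed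
  Jensen disc iff the external upward field is `≤ 0` (`newtonChild_mem_disc_iff`, proved), and the band COLLAR
  (`band_collar`): a point within `δ` of a level-`j` band point is a level-`(j+1)` band point when
  `δ·(2ρ_v + 2(j+1)·Im v + (j+2)δ) ≤ Hs² − Im v²`.

Nothing here bears on the truth of RH; RH is not proved; 33346/33347 OPEN. -/

namespace Summit.RiemannHypothesis.RiemannHypothesis.Cruxes.TiltedLandingLaw421R.Lens1

set_option linter.dupNamespace false

open Complex Set
open scoped ComplexConjugate
open Literature.Analysis.Complex
open Summit.RiemannHypothesis.RiemannHypothesis.Theorems.Splittings.JensenWindow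
open RhIdea6.G17.W07C7 RhIdea6.G17.W07C7.Rev6 RhIdea6.G18.W07C8.Law421BirthS RhIdea6.G19.W07C11.Seam
open RhIdea6.G20.W07C12.Frac RhIdea6.G20.W07C12.StColP RhW07.C12.FieldSplit RhIdea6.G21.W07C13.TentMax
open RhW07.C14.TwoSided RhW07.C14.Classes RhW07.C14.Lineage RhW07.C14.Booking
open RhW07.C13.Heredity RhIdea6.G22.W07C15pre.Injection RhW07.E3.Cell RhW07.E3.Lit
open RhW08.Round1 RhW08.StSwap RhW08.Round2 RhW08.QuadW RhW08.SealSwapQ RhW08.SealSwap RhW08.SuccB RhW08.SuccSplit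
open RhW08.SuccTheft RhW08.Column RhW08.Hurwitz RhW08.ClusterQ RhW08.ClusterQM RhW08.NewtonDoor RhW08.NewtonDoorGenusOne RhW08.PurseP
open RhW08.AntiEscapeSplit7

/-! ## §1 Idea `two-circle-pinned-count`: pin on the outer disc, certify on an inner real-centred circle -/

/-- SOCKET «cluster, level-`j`, pinned OUTER ⁄ certified INNER» (all data level-`j`).  OUTER disc `D̄(a, ρ)`, `a` real,
`ρ ≤ Hs` (anti-absorption cap: the far cofactor `h` still carries every zero farther than `Hs` from `a`), the zero list `S`
CONFINED to it and COMPLETE in it (`h ≠ 0` on the closed outer disc); INNER circle `‖z − a'‖ = ρ'`, `a'` real,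
`|a' − a| + ρ' ≤ ρ`; the COUNT `zcountNReal F a' ρ' + 2 ≤ zcountN M a' ρ'`, the DEPTH clause and the FIELD-VARIATION
inequality `‖Q‖·‖h′ − K h‖ < ‖M‖·‖h‖` are all read on the INNER circle (`F := f^{(j)}`, `Q := nearPoly S m`, `M := tiltModel S m K`).
With `(a', ρ') = (a, ρ)` this is `ClusterNumbersJ'` plus the cap; the gain is that the successor is CHARGED AT THE INNER RADIUS
(the child's own height scale), not at the outer radius that must swallow the roof. -/
def ClusterNumbersJ2 (f : ℂ → ℂ) (x₀ R Hs : ℝ) (j : ℕ) : Prop :=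
  ∃ (S : Finset ℂ) (m : ℂ → ℕ) (K : ℂ) (h : ℂ → ℂ) (a ρ a' ρ' : ℝ), 0 < ρ' ∧ ρ ≤ Hs ∧ |a' - a| + ρ' ≤ ρ ∧
    (∀ u ∈ S, ‖u - (a : ℂ)‖ ≤ ρ) ∧
    Differentiable ℂ h ∧
    (∀ z : ℂ, iteratedDeriv j f z = (nearPoly S m).eval z * h z) ∧
    (∀ z : ℂ, ‖z - (a : ℂ)‖ ≤ ρ → h z ≠ 0) ∧
    (|a' - x₀| + ρ' ≤ R / 2 ∨ (max (|a' - x₀| + ρ' - R / 2) 0) ^ 2 + ((j : ℝ) + 1) * ρ' ^ 2 ≤ ((j : ℝ) + 1) * Hs ^ 2) ∧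
    zcountNReal (iteratedDeriv j f) a' ρ' + 2 ≤ zcountN (fun z => (tiltModel S m K).eval z) a' ρ' ∧
    ∀ z : ℂ, ‖z - (a' : ℂ)‖ = ρ' →
      ‖(nearPoly S m).eval z‖ * ‖deriv h z - K * h z‖ < ‖(tiltModel S m K).eval z‖ * ‖h z‖

/-- ★ DOOR from the two-circle socket — PROVED by name from the landed band-deep tilted door
`RhW08.ClusterQM.tiltClusterLawQB_of_realBound` over the real pigeonhole `RealCritBoundNSig` (closed by name, C4 g29). -/
theorem succ_of_clusterNumbersJ2 (hRB : RealCritBoundNSig) {η : ℝ} {f : ℂ → ℂ} {x₀ s hmax R Hs : ℝ} {B j : ℕ} {v : ℂ}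
    (hE : EngineHyps5 2 η f x₀ s hmax R Hs B) (hv : StTrkDQ η f x₀ s hmax R Hs B j v) (hnR : ¬ ReadyR2 η f x₀ s hmax R Hs B j v)
    (hC : ClusterNumbersJ2 f x₀ R Hs j) : ∃ u : ℂ, StTrkDQ η f x₀ s hmax R Hs B (j + 1) u := by
  obtain ⟨S, m, K, h, a, ρ, a', ρ', hρ', -, hin, -, hh, hfac, hh0, hdepth, hn, hvar⟩ := hC
  have hsub : ∀ z : ℂ, ‖z - (a' : ℂ)‖ ≤ ρ' → ‖z - (a : ℂ)‖ ≤ ρ := by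
    intro z hz
    have h1 : ‖z - (a : ℂ)‖ ≤ ‖z - (a' : ℂ)‖ + ‖(a' : ℂ) - (a : ℂ)‖ := by
      have := norm_add_le (z - (a' : ℂ)) ((a' : ℂ) - (a : ℂ))
      rwa [sub_add_sub_cancel] at this
    have h2 : ‖(a' : ℂ) - (a : ℂ)‖ = |a' - a| := by
      rw [← Complex.ofReal_sub, Complex.norm_real, Real.norm_eq_abs]
    linarith
  refine tiltClusterLawQB_of_realBound hRB hE hv hnR hρ' hdepth
    ⟨fun z => (nearPoly S m).eval z, h, fun z => (tiltModel S m K).eval z, Polynomial.differentiable _, hh,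
      Polynomial.differentiable _, hfac, fun z hz => hh0 z (hsub z hz), rfl, fun z hz => ?_⟩ hn
  exact (variation_iff_domination K hh hfac z).mp (hvar z hz)

/-- The v7 socket is the diagonal case of the two-circle socket (under the cap `ρ ≤ Hs`). -/
theorem clusterNumbersJ2_of_J' {f : ℂ → ℂ} {x₀ R Hs : ℝ} {j : ℕ}
    (hC : ∃ (S : Finset ℂ) (m : ℂ → ℕ) (K : ℂ) (h : ℂ → ℂ) (a ρ : ℝ), 0 < ρ ∧ ρ ≤ Hs ∧ (∀ u ∈ S, ‖u - (a : ℂ)‖ ≤ ρ) ∧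
      Differentiable ℂ h ∧ (∀ z : ℂ, iteratedDeriv j f z = (nearPoly S m).eval z * h z) ∧
      (∀ z : ℂ, ‖z - (a : ℂ)‖ ≤ ρ → h z ≠ 0) ∧
      (|a - x₀| + ρ ≤ R / 2 ∨ (max (|a - x₀| + ρ - R / 2) 0) ^ 2 + ((j : ℝ) + 1) * ρ ^ 2 ≤ ((j : ℝ) + 1) * Hs ^ 2) ∧
      zcountNReal (iteratedDeriv j f) a ρ + 2 ≤ zcountN (fun z => (tiltModel S m K).eval z) a ρ ∧
      ∀ z : ℂ, ‖z - (a : ℂ)‖ = ρ →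
        ‖(nearPoly S m).eval z‖ * ‖deriv h z - K * h z‖ < ‖(tiltModel S m K).eval z‖ * ‖h z‖) :
    ClusterNumbersJ2 f x₀ R Hs j := by
  obtain ⟨S, m, K, h, a, ρ, hρ, hcap, hS, hh, hfac, hh0, hdepth, hn, hvar⟩ := hC
  exact ⟨S, m, K, h, a, ρ, a, ρ, hρ, hcap, by simp, hS, hh, hfac, hh0, hdepth, hn, hvar⟩

/-! ## §2 Idea `signed-jensen-floor`: the signed Jensen potential, the Newton-child criterion, the band collar -/

/-- PAIR TERM SIGN (PROVED; the textbook computation in Jensen's proof, read AT a zero): the conjugate pair `{c, c̄}` pushes the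
field at `v` UPWARD iff `v` lies STRICTLY INSIDE the pair's Jensen disc `D(Re c, |Im c|)` — i.e. iff `c` is a ROOF over `v`. -/
theorem pairField_im_pos_iff {v c : ℂ} (hv : 0 < v.im) (h1 : c ≠ v) (h2 : c ≠ conj v) :
    0 < ((v - c)⁻¹ + (v - conj c)⁻¹).im ↔ (v.re - c.re) ^ 2 + v.im ^ 2 < c.im ^ 2 := by
  have hvc : v - c ≠ 0 := sub_ne_zero.mpr (Ne.symm h1)
  have hvc' : v - conj c ≠ 0 := by
    intro h
    apply h2
    have : v = conj c := sub_eq_zero.mp h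
    rw [this, Complex.conj_conj]
  have hn1 : 0 < Complex.normSq (v - c) := Complex.normSq_pos.mpr hvc
  have hn2 : 0 < Complex.normSq (v - conj c) := Complex.normSq_pos.mpr hvc'
  have e1 : Complex.normSq (v - c) = (v.re - c.re) ^ 2 + (v.im - c.im) ^ 2 := by
    rw [Complex.normSq_apply]; simp [Complex.sub_re, Complex.sub_im]; ring
  have e2 : Complex.normSq (v - conj c) = (v.re - c.re) ^ 2 + (v.im + c.im) ^ 2 := by
    rw [Complex.normSq_apply]; simp [Complex.sub_re, Complex.sub_im, Complex.conj_re, Complex.conj_im]; ring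
  have him : ((v - c)⁻¹ + (v - conj c)⁻¹).im
      = (-2 * v.im * ((v.re - c.re) ^ 2 + v.im ^ 2 - c.im ^ 2)) /
          (Complex.normSq (v - c) * Complex.normSq (v - conj c)) := by
    rw [Complex.add_im, Complex.inv_im, Complex.inv_im, div_add_div _ _ hn1.ne' hn2.ne']
    congr 1
    simp only [Complex.sub_im, Complex.conj_im]
    rw [e1, e2]; ring
  rw [him]
  have hden : 0 < Complex.normSq (v - c) * Complex.normSq (v - conj c) := mul_pos hn1 hn2
  rw [div_pos_iff_of_pos_right hden]
  constructor
  · intro h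
    nlinarith [mul_pos hv hv]
  · intro h
    have : 0 < c.im ^ 2 - ((v.re - c.re) ^ 2 + v.im ^ 2) := by linarith
    nlinarith [mul_pos hv this]

/-- FLOOR TERM SIGN: a real zero `x` pushes the field at `v` DOWNWARD (inward), by `−Im v/‖v − x‖²`. -/
theorem realField_im_neg {v : ℂ} (hv : 0 < v.im) (x : ℝ) (hx : (x : ℂ) ≠ v) : ((v - (x : ℂ))⁻¹).im < 0 := by
  have hne : v - (x : ℂ) ≠ 0 := sub_ne_zero.mpr (Ne.symm hx)
  rw [Complex.inv_im, Complex.sub_im, Complex.ofReal_im, sub_zero]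
  have hpos : 0 < Complex.normSq (v - (x : ℂ)) := Complex.normSq_pos.mpr hne
  exact div_neg_of_neg_of_pos (neg_neg_of_pos hv) hpos

/-- NEWTON-CHILD CRITERION (PROVED; exact identity): for `v = X + iy` and the EXTERNAL field `Kext` (everything except the self-conjugate
term `1/(v − v̄) = −i/(2y)`), the Newton child `v − 1/(Kext − i/(2y))` lies in `v`'s own closed Jensen disc `D̄(X, y)` iff `Im Kext ≤ 0`
(`‖iy − 1/K_v‖ ≤ y ⟺ 1 + 2y·Im K_v ≤ 0`). -/
theorem newtonChild_mem_disc_iff {X y : ℝ} (hy : 0 < y) {Kext : ℂ} (hK : Kext - I / (2 * (y : ℂ)) ≠ 0) :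
    ‖((X : ℂ) + (y : ℂ) * I - (Kext - I / (2 * (y : ℂ)))⁻¹) - (X : ℂ)‖ ≤ y ↔ Kext.im ≤ 0 := by
  generalize hKdef : Kext - I / (2 * (y : ℂ)) = K at hK ⊢
  have hKim : 1 + 2 * y * K.im = 2 * y * Kext.im := by
    rw [← hKdef]
    have h2y : (2 : ℂ) * (y : ℂ) = ((2 * y : ℝ) : ℂ) := by push_cast; ring
    have hI : (I / (2 * (y : ℂ))).im = 1 / (2 * y) := by
      rw [h2y, Complex.div_ofReal_im]; simp
    rw [Complex.sub_im, hI]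
    field_simp
    ring
  have hn : 0 < Complex.normSq K := Complex.normSq_pos.mpr hK
  have hexpr : ((X : ℂ) + (y : ℂ) * I - K⁻¹) - (X : ℂ) = (y : ℂ) * I - K⁻¹ := by ring
  rw [hexpr]
  have hre : ((y : ℂ) * I - K⁻¹).re = -(K.re / Complex.normSq K) := by
    simp [Complex.sub_re, Complex.mul_re, Complex.inv_re]
  have him : ((y : ℂ) * I - K⁻¹).im = y + K.im / Complex.normSq K := by
    simp [Complex.sub_im, Complex.mul_im, Complex.inv_im]
    ring
  have key : Complex.normSq ((y : ℂ) * I - K⁻¹) * Complex.normSq K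
      = y ^ 2 * Complex.normSq K + (1 + 2 * y * K.im) := by
    have hnK : Complex.normSq K = K.re * K.re + K.im * K.im := Complex.normSq_apply K
    rw [Complex.normSq_apply ((y : ℂ) * I - K⁻¹), hre, him]
    field_simp
    rw [hnK]; ring
  have hsq : ‖(y : ℂ) * I - K⁻¹‖ ≤ y ↔ Complex.normSq ((y : ℂ) * I - K⁻¹) ≤ y ^ 2 := by
    rw [Complex.normSq_eq_norm_sq]
    exact (pow_le_pow_iff_left₀ (norm_nonneg _) hy.le two_ne_zero).symm
  rw [hsq]
  constructor
  · intro h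
    have h2 := mul_le_mul_of_nonneg_right h hn.le
    rw [key] at h2
    have h3 : 2 * y * Kext.im ≤ 0 := by rw [← hKim]; linarith
    by_contra hc
    push Not at hc
    nlinarith [mul_pos hy hc]
  · intro h
    have h3 : 1 + 2 * y * K.im ≤ 0 := by rw [hKim]; nlinarith
    have h2 : Complex.normSq ((y : ℂ) * I - K⁻¹) * Complex.normSq K ≤ y ^ 2 * Complex.normSq K := by
      rw [key]; linarith
    exact le_of_mul_le_mul_right h2 hn

/-- BAND COLLAR (exact algebra): a point `w` within `δ` of a level-`j` band point `v` (`(ρ_v)₊² + j·Im v² ≤ j·Hs²`, `0 ≤ Im v ≤ Hs`)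
satisfies the level-`(j+1)` band inequality as soon as `δ·(2ρ_v + 2(j+1)·Im v + (j+2)·δ) ≤ Hs² − Im v²` — the collar has width
`≍ (Hs − Im v)/(j+1)`; an `s`-scale displacement cannot leave the band below the top layer while `(j+2)·s ≲ Hs − Im v`. (Proved: algebra.) -/
theorem band_collar {x₀ R Hs : ℝ} {j : ℕ} {v w : ℂ} {δ : ℝ}
    (hv : (max (|v.re - x₀| - R / 2) 0) ^ 2 + (j : ℝ) * v.im ^ 2 ≤ (j : ℝ) * Hs ^ 2) (hvim : 0 ≤ v.im)
    (hδ : 0 ≤ δ) (hw : ‖w - v‖ ≤ δ)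
    (hslack : δ * (2 * max (|v.re - x₀| - R / 2) 0 + 2 * ((j : ℝ) + 1) * v.im + ((j : ℝ) + 2) * δ) ≤ Hs ^ 2 - v.im ^ 2) :
    (max (|w.re - x₀| - R / 2) 0) ^ 2 + ((j : ℝ) + 1) * w.im ^ 2 ≤ ((j : ℝ) + 1) * Hs ^ 2 := by
  have hre : |w.re - v.re| ≤ δ := le_trans (by simpa using Complex.abs_re_le_norm (w - v)) hw
  have him : |w.im - v.im| ≤ δ := le_trans (by simpa using Complex.abs_im_le_norm (w - v)) hw
  set ρv := max (|v.re - x₀| - R / 2) 0 with hρv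
  have hρv0 : 0 ≤ ρv := le_max_right _ _
  have hρw : max (|w.re - x₀| - R / 2) 0 ≤ ρv + δ := by
    have h1 : |w.re - x₀| ≤ |v.re - x₀| + δ := by
      have := abs_sub_le (w.re) (v.re) x₀
      linarith [abs_sub_comm w.re v.re]
    refine max_le ?_ (by linarith)
    have := le_max_left (|v.re - x₀| - R / 2) 0
    linarith
  have hρw0 : 0 ≤ max (|w.re - x₀| - R / 2) 0 := le_max_right _ _
  have hwim : |w.im| ≤ v.im + δ := by
    have := abs_sub_abs_le_abs_sub w.im v.im
    rw [abs_of_nonneg hvim] at this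
    linarith
  have hsq1 : (max (|w.re - x₀| - R / 2) 0) ^ 2 ≤ (ρv + δ) ^ 2 := pow_le_pow_left₀ hρw0 hρw 2
  have hsq2 : w.im ^ 2 ≤ (v.im + δ) ^ 2 := by
    have h0 : 0 ≤ |w.im| := abs_nonneg _
    have := pow_le_pow_left₀ h0 hwim 2
    simpa [sq_abs] using this
  have hj : (0 : ℝ) ≤ (j : ℝ) := Nat.cast_nonneg j
  nlinarith [hsq1, hsq2, hv, hslack, hj, mul_nonneg hj (sub_nonneg.mpr hsq2)]

/-! ## §3 NODE composition: the law with the two-circle disjunct (WEAKER than v7) still closes the SUCC residual BY NAME -/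

/-- The v7 law with ONE more disjunct, the two-circle socket `ClusterNumbersJ2` (strictly more ways to be true ⇒ WEAKER as a law). -/
def DoorAvailLawQ2 : Prop :=
  ∀ (η : ℝ) (f : ℂ → ℂ) (x₀ s hmax R Hs : ℝ) (B : ℕ), EngineHyps5 2 η f x₀ s hmax R Hs B → ∀ (j : ℕ) (v : ℂ),
    IsLowest StTrkDQ η f x₀ s hmax R Hs B j v → ¬ ReadyR2 η f x₀ s hmax R Hs B j v →
    ¬ AllInBandInRangeWindow f x₀ R Hs j v → ¬ Dimple f j v → DiscOverlap f j v →
    iteratedDeriv (j + 1) f v ≠ 0 →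
    NewtonNumbers f x₀ R Hs j v ∨ NewtonNumbersCol f x₀ R Hs j ∨ ClusterNumbersJ' f x₀ R Hs j ∨ ClusterNumbersU f x₀ R j ∨
      CornerWindow f x₀ R Hs j ∨ ClusterNumbersJ2 f x₀ R Hs j

/-- WEAKER: v7 ⇒ v7 + J2. -/
theorem doorAvail2_of_doorAvail7 (hL : DoorAvailLawQ) : DoorAvailLawQ2 := by
  intro η f x₀ s hmax R Hs B hE j v hlow hnR hwin hdim hov hz
  rcases hL η f x₀ s hmax R Hs B hE j v hlow hnR hwin hdim hov hz with h | h | h | h | h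
  · exact Or.inl h
  · exact Or.inr (Or.inl h)
  · exact Or.inr (Or.inr (Or.inl h))
  · exact Or.inr (Or.inr (Or.inr (Or.inl h)))
  · exact Or.inr (Or.inr (Or.inr (Or.inr (Or.inl h))))

/-- ★ The weaker law still closes the OPEN node `AntiEscapeCore` (door by door; the sixth door is `succ_of_clusterNumbersJ2`). -/
theorem antiEscapeCore_of_doorAvail2 (hRB : RealCritBoundNSig) (hL : DoorAvailLawQ2) : AntiEscapeCore := by
  intro η f x₀ s hmax R Hs B hE j v hlow hnR hwin hdim hov
  by_cases hz : iteratedDeriv (j + 1) f v = 0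
  · exact succ_of_multiple hE hlow.1 hz
  rcases hL η f x₀ s hmax R Hs B hE j v hlow hnR hwin hdim hov hz with hN | hNc | hC | hU | hW | hJ2
  · exact succ_of_newtonNumbers hE hlow.1 hN
  · exact succ_of_newtonNumbersCol hE hlow.1 hNc
  · exact succ_of_clusterNumbersJ' hRB hE hlow.1 hnR hC
  · exact succ_of_clusterNumbersU hE hlow.1 hU
  · exact succ_of_cornerWindow hE hlow.1 hnR hW
  · exact succ_of_clusterNumbersJ2 hRB hE hlow.1 hnR hJ2

/-- ★ … hence the registered stub's SUCC statement `RestSuccBotQ` and, with the RATE half, the crux text at `κ = ½` — all BY NAME. -/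
theorem restSuccBotQ_of_doorAvail2 (hRB : RealCritBoundNSig) (hL : DoorAvailLawQ2) : RestSuccBotQ :=
  restSuccBotQ_of_pieces dimpleSig_holds (antiEscape_of_core (antiEscapeCore_of_doorAvail2 hRB hL))

theorem law421Half_of_doorAvail2_rate (hRB : RealCritBoundNSig) (hL : DoorAvailLawQ2) (hR : RestRateBotPQ halfPurse) :
    Law421P halfPurse :=
  law421Half_of_succ_rate (restSuccBotQ_of_doorAvail2 hRB hL) hR

/-- NODE CHECK: the pieces reach the crux decl BY NAME (S2 closed by `realCritBoundNSig_holds`). -/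
theorem TiltedLandingLaw421R_of_doorAvail2 (hL : DoorAvailLawQ2) (hR : RestRateBotPQ halfPurse) :
    Summit.RiemannHypothesis.RiemannHypothesis.Theses.EarlyAppointments.TiltedLandingLaw421R :=
  law421Half_of_doorAvail2_rate RhW08.ClusterQM.realCritBoundNSig_holds hL hR

/-! ## §4 Door N♯ (idea `signed-jensen-floor`, typed consequence of (I2)): the Newton door with the scalar slack N5 AND the
regime clause `1 < ‖K‖·Im v` both REPLACED by ONE geometric clause — the Newton disc lies inside `v`'s own closed Jensen disc
`D̄(Re v, Im v)`; band membership of the successor is then Jensen nesting (`RhW08.QuadW.band_of_hang`), charged at the CHILD's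
position, not at `Im v + (1+ρ₀)/‖K‖`.  By (I2) the clause is the un-roofed ⁄ floor-dominant regime `Im K_ext ≤ −(margin)`. -/

/-- The Newton door chain of `RhW08.NewtonDoor` with the WHOLE-DISC band clause `hdisc` kept abstract (Lipschitz form). -/
theorem succ_of_newton_door_lip_disc {η : ℝ} {f : ℂ → ℂ} {x₀ s hmax R Hs : ℝ} {B j : ℕ} {v : ℂ}
    (hE : EngineHyps5 2 η f x₀ s hmax R Hs B) (hv : StTrkDQ η f x₀ s hmax R Hs B j v) {K : ℂ} (hK : K ≠ 0)
    {ρ₀ Λ : ℝ} (hρ₀ : 0 < ρ₀) (hΛ : (1 + ρ₀) * Λ < ρ₀ * ‖K‖) (hoff : ρ₀ / ‖K‖ ≤ |(v - K⁻¹).im|)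
    (hh0 : ∀ z : ℂ, ‖z - (v - K⁻¹)‖ ≤ ρ₀ / ‖K‖ → dslope (iteratedDeriv j f) v z ≠ 0)
    (hlip : ∀ z : ℂ, ‖z - (v - K⁻¹)‖ = ρ₀ / ‖K‖ →
      ‖deriv (dslope (iteratedDeriv j f) v) z / dslope (iteratedDeriv j f) v z - K‖ ≤ Λ)
    (hdisc : ∀ z : ℂ, ‖z - (v - K⁻¹)‖ < ρ₀ / ‖K‖ → |z.im| ≤ Hs →
      (max (|z.re - x₀| - R / 2) 0) ^ 2 + ((j : ℝ) + 1) * z.im ^ 2 ≤ ((j : ℝ) + 1) * Hs ^ 2) :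
    ∃ u : ℂ, StTrkDQ η f x₀ s hmax R Hs B (j + 1) u :=
  succ_of_newton_door' hE hv hK hρ₀ hoff hh0 (fieldVariation_of_lipschitz hK hΛ hh0 hlip) hdisc

/-- Two-point form with `hdisc`. -/
theorem succ_of_newton_door_twoPointU_disc {η : ℝ} {f : ℂ → ℂ} {x₀ s hmax R Hs : ℝ} {B j : ℕ} {v : ℂ}
    (hE : EngineHyps5 2 η f x₀ s hmax R Hs B) (hv : StTrkDQ η f x₀ s hmax R Hs B j v) {K : ℂ} (hK : K ≠ 0)
    {ρ₀ : ℝ} (hρ₀ : 0 < ρ₀) (hoff : ρ₀ / ‖K‖ ≤ |(v - K⁻¹).im|)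
    {ι : Type*} (a : ι → ℂ) (m : ι → ℝ) (hm : ∀ i, 0 ≤ m i)
    (hzeros : ∀ z, dslope (iteratedDeriv j f) v z = 0 → ∃ i, z = a i)
    (hineq : ∀ z : ℂ, ‖z - (v - K⁻¹)‖ = ρ₀ / ‖K‖ →
      ‖deriv (dslope (iteratedDeriv j f) v) z / dslope (iteratedDeriv j f) v z - K‖ ≤ ‖z - v‖ * ∑' i, m i / (‖z - a i‖ * ‖v - a i‖))
    (hSv : Summable fun i => m i / (‖v - a i‖ * ‖v - a i‖))
    {δ : ℝ} (hδ : 0 < δ) (hsep : ∀ i, (1 + ρ₀) / ‖K‖ + δ ≤ ‖v - a i‖)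
    (hend : (1 + ρ₀) * ((1 + ρ₀) / ‖K‖ * ∑' i, m i / ((‖v - a i‖ - (1 + ρ₀) / ‖K‖) * ‖v - a i‖)) < ρ₀ * ‖K‖)
    (hdisc : ∀ z : ℂ, ‖z - (v - K⁻¹)‖ < ρ₀ / ‖K‖ → |z.im| ≤ Hs →
      (max (|z.re - x₀| - R / 2) 0) ^ 2 + ((j : ℝ) + 1) * z.im ^ 2 ≤ ((j : ℝ) + 1) * Hs ^ 2) :
    ∃ u : ℂ, StTrkDQ η f x₀ s hmax R Hs B (j + 1) u := by
  have hKn : 0 < ‖K‖ := norm_pos_iff.mpr hK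
  have hrN : 0 ≤ (1 + ρ₀) / ‖K‖ := by positivity
  have hsep' : ∀ i, 0 < m i → (1 + ρ₀) / ‖K‖ < ‖v - a i‖ := fun i _ => by linarith [hsep i]
  have hh0 : ∀ z : ℂ, ‖z - (v - K⁻¹)‖ ≤ ρ₀ / ‖K‖ → dslope (iteratedDeriv j f) v z ≠ 0 := by
    intro z hz hz0
    obtain ⟨i, rfl⟩ := hzeros z hz0
    have h1 : ‖a i - v‖ ≤ (1 + ρ₀) / ‖K‖ := norm_sub_le_of_newtonDisc hK hz
    have h2 := hsep i
    rw [norm_sub_rev] at h2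
    linarith
  have hS := summable_majorant_of_uniform_sep a m hm hrN hδ (fun i _ => hsep i) hSv
  refine succ_of_newton_door_lip_disc hE hv hK hρ₀ hend hoff hh0 ?_ hdisc
  intro z hz
  exact le_trans (hineq z hz) (tsum_twoPoint_le a m hm (norm_sub_le_of_newtonDisc hK (le_of_eq hz)) hsep' hS)

/-- Genus-one primitive-data form with `hdisc` (body = `RhW08.NewtonDoorGenusOne.succ_of_newton_door_genusOne`, last line changed). -/
theorem succ_of_newton_door_genusOne_disc {η : ℝ} {f : ℂ → ℂ} {x₀ s hmax R Hs : ℝ} {B j : ℕ} {v : ℂ}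
    (hE : EngineHyps5 2 η f x₀ s hmax R Hs B) (hv : StTrkDQ η f x₀ s hmax R Hs B j v)
    {C ρ : ℝ} (hFd : Differentiable ℂ (iteratedDeriv j f))
    (hgrowth : ∀ z, ‖iteratedDeriv j f z‖ ≤ C * Real.exp (‖z‖ ^ ρ)) (hρ : ρ < 2)
    (hFv : iteratedDeriv j f v = 0) (hsimple : analyticOrderAt (iteratedDeriv j f) v = 1)
    {K : ℂ} (hKdef : K = deriv (dslope (iteratedDeriv j f) v) v / dslope (iteratedDeriv j f) v v)
    (hK : K ≠ 0) {ρ₀ : ℝ} (hρ₀ : 0 < ρ₀) (hoff : ρ₀ / ‖K‖ ≤ |(v - K⁻¹).im|)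
    {δ : ℝ} (hδ : 0 < δ)
    (hsepZ : ∀ c, dslope (iteratedDeriv j f) v c = 0 → (1 + ρ₀) / ‖K‖ + δ ≤ ‖v - c‖)
    (hendZ : (1 + ρ₀) * ((1 + ρ₀) / ‖K‖ * ∑' c : ℂ, (analyticOrderNatAt (dslope (iteratedDeriv j f) v) c : ℝ) /
        ((‖v - c‖ - (1 + ρ₀) / ‖K‖) * ‖v - c‖)) < ρ₀ * ‖K‖)
    (hdisc : ∀ z : ℂ, ‖z - (v - K⁻¹)‖ < ρ₀ / ‖K‖ → |z.im| ≤ Hs →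
      (max (|z.re - x₀| - R / 2) 0) ^ 2 + ((j : ℝ) + 1) * z.im ^ 2 ≤ ((j : ℝ) + 1) * Hs ^ 2) :
    ∃ u : ℂ, StTrkDQ η f x₀ s hmax R Hs B (j + 1) u := by
  obtain ⟨ι, a, m, hm, haF, hm1, hcard, hfiber, hzeros, hEnd, htwo⟩ :=
    GenusOneLogDerivC3g41.twoPoint_bound_dslope hFd hgrowth hρ hFv hsimple
  have hv0 : dslope (iteratedDeriv j f) v v ≠ 0 := by
    rw [dslope_same]
    exact Literature.Barriers.RiemannHypothesis.deriv_ne_zero_of_analyticOrderAt_eq_one (hFd.analyticAt v) hsimple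
  have ha0 : ∀ i, dslope (iteratedDeriv j f) v (a i) = 0 := by
    intro i
    obtain ⟨hz, hne⟩ := haF i
    rw [dslope_of_ne _ hne, slope_def_field, hz, hFv, sub_zero, zero_div]
  have hsep : ∀ i, (1 + ρ₀) / ‖K‖ + δ ≤ ‖v - a i‖ := fun i ↦ hsepZ (a i) (ha0 i)
  have hKn : 0 < ‖K‖ := norm_pos_iff.2 hK
  have hcirc : ∀ z : ℂ, ‖z - (v - K⁻¹)‖ = ρ₀ / ‖K‖ → dslope (iteratedDeriv j f) v z ≠ 0 := by
    intro z hz hz0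
    have h1 : (1 + ρ₀) / ‖K‖ + δ ≤ ‖v - z‖ := hsepZ z hz0
    have h2 : ‖v - z‖ ≤ ρ₀ / ‖K‖ + 1 / ‖K‖ := by
      calc ‖v - z‖ = ‖(v - K⁻¹ - z) + K⁻¹‖ := by congr 1; ring
        _ ≤ ‖v - K⁻¹ - z‖ + ‖K⁻¹‖ := norm_add_le _ _
        _ = ρ₀ / ‖K‖ + 1 / ‖K‖ := by rw [norm_sub_rev, hz, norm_inv, one_div]
    have h3 : ρ₀ / ‖K‖ + 1 / ‖K‖ = (1 + ρ₀) / ‖K‖ := by rw [add_div, add_comm]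
    linarith
  have hzeros' : ∀ z, dslope (iteratedDeriv j f) v z = 0 → ∃ i, z = a i :=
    fun z hz ↦ (hzeros z hz).imp fun i hi ↦ hi.1
  have hineq : ∀ z : ℂ, ‖z - (v - K⁻¹)‖ = ρ₀ / ‖K‖ →
      ‖deriv (dslope (iteratedDeriv j f) v) z / dslope (iteratedDeriv j f) v z - K‖ ≤
        ‖z - v‖ * ∑' i, m i / (‖z - a i‖ * ‖v - a i‖) := by
    intro z hz
    rw [hKdef]
    exact (htwo z v (hcirc z hz) hv0).2
  have hSv : Summable fun i ↦ m i / (‖v - a i‖ * ‖v - a i‖) := (htwo v v hv0 hv0).1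
  have hs1 : Summable fun i ↦ m i / ((‖v - a i‖ - (1 + ρ₀) / ‖K‖) * ‖v - a i‖) :=
    hEnd ((1 + ρ₀) / ‖K‖) (by positivity) (fun i ↦ by linarith [hsep i])
  have hs2 : Summable fun i ↦ m i * (1 / ((‖v - a i‖ - (1 + ρ₀) / ‖K‖) * ‖v - a i‖)) :=
    hs1.congr fun i ↦ by ring
  have h3 := (hfiber (fun c ↦ 1 / ((‖v - c‖ - (1 + ρ₀) / ‖K‖) * ‖v - c‖)) hs2).tsum_eq
  have hEq : ∑' i, m i / ((‖v - a i‖ - (1 + ρ₀) / ‖K‖) * ‖v - a i‖) =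
      ∑' c : ℂ, (analyticOrderNatAt (dslope (iteratedDeriv j f) v) c : ℝ) /
        ((‖v - c‖ - (1 + ρ₀) / ‖K‖) * ‖v - c‖) := by
    rw [show (fun i ↦ m i / ((‖v - a i‖ - (1 + ρ₀) / ‖K‖) * ‖v - a i‖)) =
        fun i ↦ m i * (1 / ((‖v - a i‖ - (1 + ρ₀) / ‖K‖) * ‖v - a i‖)) from funext fun i ↦ by ring, ← h3]
    exact tsum_congr fun c ↦ by ring
  have hend : (1 + ρ₀) * ((1 + ρ₀) / ‖K‖ *
      ∑' i, m i / ((‖v - a i‖ - (1 + ρ₀) / ‖K‖) * ‖v - a i‖)) < ρ₀ * ‖K‖ := by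
    rw [hEq]
    exact hendZ
  exact succ_of_newton_door_twoPointU_disc hE hv hK hρ₀ hoff a m hm hzeros' hineq hSv hδ hsep hend hdisc

/-- NEWTON NUMBERS♯ with data `(K, ρ₀, δ)`: N1 `K ≠ 0`, N3 off-axis, N4 separation + END number — and, replacing BOTH the regime clause
`1 < ‖K‖·Im v` and the scalar slack N5, the JENSEN-DISC CLAUSE `‖(v − K⁻¹) − Re v‖ + ρ₀/‖K‖ ≤ Im v` (the closed Newton disc inside `v`'s own
closed Jensen disc).  FRAME-FREE: no `x₀, R, Hs`. By `newtonChild_mem_disc_iff` the centre condition is `Im K_ext ≤ 0`; the clause is its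
version with margin `ρ₀/‖K‖`. -/
def NewtonNumbersSharpWith (f : ℂ → ℂ) (j : ℕ) (v K : ℂ) (ρ₀ δ : ℝ) : Prop :=
  K ≠ 0 ∧ 0 < ρ₀ ∧ ρ₀ / ‖K‖ ≤ |(v - K⁻¹).im| ∧ 0 < δ ∧
    (∀ c : ℂ, dslope (iteratedDeriv j f) v c = 0 → (1 + ρ₀) / ‖K‖ + δ ≤ ‖v - c‖) ∧
    (1 + ρ₀) * ((1 + ρ₀) / ‖K‖ * ∑' c : ℂ, (analyticOrderNatAt (dslope (iteratedDeriv j f) v) c : ℝ) /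
        ((‖v - c‖ - (1 + ρ₀) / ‖K‖) * ‖v - c‖)) < ρ₀ * ‖K‖ ∧
    ‖(v - K⁻¹) - (v.re : ℂ)‖ + ρ₀ / ‖K‖ ≤ v.im

/-- ★ SOCKET «Newton♯» at the canonical field value. -/
def NewtonNumbersSharp (f : ℂ → ℂ) (j : ℕ) (v : ℂ) : Prop :=
  ∃ ρ₀ δ : ℝ, NewtonNumbersSharpWith f j v (newtonK f j v) ρ₀ δ

/-- The Jensen-disc clause gives the WHOLE-DISC band clause by Jensen nesting (`band_of_hang`): every point of the open Newton disc is a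
`NestedStep` child of the band state `v`. -/
theorem hdisc_of_jensenDisc {η : ℝ} {f : ℂ → ℂ} {x₀ s hmax R Hs : ℝ} {B j : ℕ} {v K : ℂ} {ρ₀ : ℝ}
    (hv : StTrkDQ η f x₀ s hmax R Hs B j v) (hJ : ‖(v - K⁻¹) - (v.re : ℂ)‖ + ρ₀ / ‖K‖ ≤ v.im) :
    ∀ z : ℂ, ‖z - (v - K⁻¹)‖ < ρ₀ / ‖K‖ → |z.im| ≤ Hs →
      (max (|z.re - x₀| - R / 2) 0) ^ 2 + ((j : ℝ) + 1) * z.im ^ 2 ≤ ((j : ℝ) + 1) * Hs ^ 2 := by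
  intro z hz _
  have hv' : StColQ' η f x₀ s hmax R Hs B j v := hv
  apply band_of_hang hv'
  -- `NestedStep v z`: `(z.re − v.re)² + z.im² ≤ v.im²`
  have h1 : ‖z - (v.re : ℂ)‖ ≤ v.im := by
    calc ‖z - (v.re : ℂ)‖ = ‖(z - (v - K⁻¹)) + ((v - K⁻¹) - (v.re : ℂ))‖ := by congr 1; ring
      _ ≤ ‖z - (v - K⁻¹)‖ + ‖(v - K⁻¹) - (v.re : ℂ)‖ := norm_add_le _ _
      _ ≤ v.im := by linarith
  have hy : 0 ≤ v.im := le_trans (norm_nonneg _) h1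
  have h2 : ‖z - (v.re : ℂ)‖ ^ 2 ≤ v.im ^ 2 := pow_le_pow_left₀ (norm_nonneg _) h1 2
  have h3 : ‖z - (v.re : ℂ)‖ ^ 2 = (z.re - v.re) ^ 2 + z.im ^ 2 := by
    rw [← Complex.normSq_eq_norm_sq, Complex.normSq_apply]
    simp [Complex.sub_re, Complex.sub_im]
    ring
  unfold NestedStep
  linarith [h2, h3]

/-- ★★ DOOR N♯: a legal frame, a band state `v`, and Newton numbers♯ ⇒ the successor state (multiple zero: `succ_of_multiple`; simple zero:
the genus-one engine with the whole-disc clause from `hdisc_of_jensenDisc`).  No `1 < ‖K‖·Im v`, no scalar slack. -/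
theorem succ_of_newtonNumbersSharp {η : ℝ} {f : ℂ → ℂ} {x₀ s hmax R Hs : ℝ} {B j : ℕ} {v : ℂ}
    (hE : EngineHyps5 2 η f x₀ s hmax R Hs B) (hv : StTrkDQ η f x₀ s hmax R Hs B j v) (hN : NewtonNumbersSharp f j v) :
    ∃ u : ℂ, StTrkDQ η f x₀ s hmax R Hs B (j + 1) u := by
  by_cases hz : iteratedDeriv (j + 1) f v = 0
  · exact succ_of_multiple hE hv hz
  obtain ⟨ρ₀, δ, hK, hρ₀, hoff, hδ, hsepZ, hendZ, hJ⟩ := hN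
  have hf : Summit.RiemannHypothesis.RiemannHypothesis.Theorems.Splittings.JensenWindow.RealEntireLt2 f :=
    realEntireLt2_of_hyps hE
  obtain ⟨ρ, C, hρ0, hρ, hgr⟩ := hf.growth
  obtain ⟨ρ', C', -, hρ', hgr'⟩ := Literature.Analysis.Complex.exists_growth_iteratedDeriv hf.diff hρ0 hρ hgr j
  have hFd : Differentiable ℂ (iteratedDeriv j f) := differentiable_iteratedDeriv_of_entire hE.1 j
  have hv' : StColQ' η f x₀ s hmax R Hs B j v := hv
  obtain ⟨-, hFv, -⟩ := hv'
  have hderiv : deriv (iteratedDeriv j f) v ≠ 0 := by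
    rw [← iteratedDeriv_succ]; exact hz
  have hsimple : analyticOrderAt (iteratedDeriv j f) v = 1 :=
    (hFd.analyticAt v).analyticOrderAt_eq_one_of_zero_deriv_ne_zero hFv hderiv
  exact succ_of_newton_door_genusOne_disc hE hv hFd hgr' hρ' hFv hsimple rfl hK hρ₀ hoff hδ hsepZ hendZ
    (hdisc_of_jensenDisc hv hJ)

/-- The v7 law with N♯ as a further disjunct still closes `AntiEscapeCore` (and hence `RestSuccBotQ`, the crux) BY NAME. -/
def DoorAvailLawQ3 : Prop :=
  ∀ (η : ℝ) (f : ℂ → ℂ) (x₀ s hmax R Hs : ℝ) (B : ℕ), EngineHyps5 2 η f x₀ s hmax R Hs B → ∀ (j : ℕ) (v : ℂ),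
    IsLowest StTrkDQ η f x₀ s hmax R Hs B j v → ¬ ReadyR2 η f x₀ s hmax R Hs B j v →
    ¬ AllInBandInRangeWindow f x₀ R Hs j v → ¬ Dimple f j v → DiscOverlap f j v →
    iteratedDeriv (j + 1) f v ≠ 0 →
    NewtonNumbers f x₀ R Hs j v ∨ NewtonNumbersCol f x₀ R Hs j ∨ ClusterNumbersJ' f x₀ R Hs j ∨ ClusterNumbersU f x₀ R j ∨
      CornerWindow f x₀ R Hs j ∨ ClusterNumbersJ2 f x₀ R Hs j ∨ NewtonNumbersSharp f j v

theorem doorAvail3_of_doorAvail2 (hL : DoorAvailLawQ2) : DoorAvailLawQ3 := by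
  intro η f x₀ s hmax R Hs B hE j v hlow hnR hwin hdim hov hz
  rcases hL η f x₀ s hmax R Hs B hE j v hlow hnR hwin hdim hov hz with h | h | h | h | h | h
  · exact Or.inl h
  · exact Or.inr (Or.inl h)
  · exact Or.inr (Or.inr (Or.inl h))
  · exact Or.inr (Or.inr (Or.inr (Or.inl h)))
  · exact Or.inr (Or.inr (Or.inr (Or.inr (Or.inl h))))
  · exact Or.inr (Or.inr (Or.inr (Or.inr (Or.inr (Or.inl h)))))

theorem antiEscapeCore_of_doorAvail3 (hRB : RealCritBoundNSig) (hL : DoorAvailLawQ3) : AntiEscapeCore := by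
  intro η f x₀ s hmax R Hs B hE j v hlow hnR hwin hdim hov
  by_cases hz : iteratedDeriv (j + 1) f v = 0
  · exact succ_of_multiple hE hlow.1 hz
  rcases hL η f x₀ s hmax R Hs B hE j v hlow hnR hwin hdim hov hz with hN | hNc | hC | hU | hW | hJ2 | hNs
  · exact succ_of_newtonNumbers hE hlow.1 hN
  · exact succ_of_newtonNumbersCol hE hlow.1 hNc
  · exact succ_of_clusterNumbersJ' hRB hE hlow.1 hnR hC
  · exact succ_of_clusterNumbersU hE hlow.1 hU
  · exact succ_of_cornerWindow hE hlow.1 hnR hW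
  · exact succ_of_clusterNumbersJ2 hRB hE hlow.1 hnR hJ2
  · exact succ_of_newtonNumbersSharp hE hlow.1 hNs

theorem TiltedLandingLaw421R_of_doorAvail3 (hL : DoorAvailLawQ3) (hR : RestRateBotPQ halfPurse) :
    Summit.RiemannHypothesis.RiemannHypothesis.Theses.EarlyAppointments.TiltedLandingLaw421R :=
  law421Half_of_succ_rate
    (restSuccBotQ_of_pieces dimpleSig_holds (antiEscape_of_core (antiEscapeCore_of_doorAvail3 RhW08.ClusterQM.realCritBoundNSig_holds hL))) hR

/-! ## §5 Under the SUCC law OF RECORD v8 = `RhW08.LandingDoor.DoorAvailLawQ8` (#1124, registry v6q): v9 := v8 ∨ J2 ∨ N♯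

Director CA441 door-integration rule: J2 / N♯ become law text only if instr-1's TABLE S shows a row they lift; the compositions below only
certify that the WEAKER law still reaches the crux decl BY NAME (no registry change is asked). -/

/-- v9 CANDIDATE text: v8's six sockets plus `ClusterNumbersJ2` (two-circle pinned count) plus `NewtonNumbersSharp` (door N♯). -/
def DoorAvailLawQ9 : Prop :=
  ∀ (η : ℝ) (f : ℂ → ℂ) (x₀ s hmax R Hs : ℝ) (B : ℕ), EngineHyps5 2 η f x₀ s hmax R Hs B → ∀ (j : ℕ) (v : ℂ),
    IsLowest StTrkDQ η f x₀ s hmax R Hs B j v → ¬ ReadyR2 η f x₀ s hmax R Hs B j v →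
    ¬ AllInBandInRangeWindow f x₀ R Hs j v → ¬ Dimple f j v → DiscOverlap f j v →
    iteratedDeriv (j + 1) f v ≠ 0 →
    NewtonNumbers f x₀ R Hs j v ∨ NewtonNumbersCol f x₀ R Hs j ∨ ClusterNumbersJ' f x₀ R Hs j ∨ ClusterNumbersU f x₀ R j ∨
      RhW08.LandingDoor.LandingNumbers f x₀ R Hs j ∨ CornerWindow f x₀ R Hs j ∨ ClusterNumbersJ2 f x₀ R Hs j ∨
      NewtonNumbersSharp f j v

/-- v9 is WEAKER than the law of record v8. -/
theorem doorAvail9_of_doorAvail8 (hL : RhW08.LandingDoor.DoorAvailLawQ8) : DoorAvailLawQ9 := by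
  intro η f x₀ s hmax R Hs B hE j v hlow hnR hwin hdim hov hz
  rcases hL η f x₀ s hmax R Hs B hE j v hlow hnR hwin hdim hov hz with h | h | h | h | h | h
  · exact Or.inl h
  · exact Or.inr (Or.inl h)
  · exact Or.inr (Or.inr (Or.inl h))
  · exact Or.inr (Or.inr (Or.inr (Or.inl h)))
  · exact Or.inr (Or.inr (Or.inr (Or.inr (Or.inl h))))
  · exact Or.inr (Or.inr (Or.inr (Or.inr (Or.inr (Or.inl h)))))

/-- v9 is WEAKER than this file's v3 (v7 ∨ J2 ∨ N♯). -/
theorem doorAvail9_of_doorAvail3 (hL : DoorAvailLawQ3) : DoorAvailLawQ9 := by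
  intro η f x₀ s hmax R Hs B hE j v hlow hnR hwin hdim hov hz
  rcases hL η f x₀ s hmax R Hs B hE j v hlow hnR hwin hdim hov hz with h | h | h | h | h | h | h
  · exact Or.inl h
  · exact Or.inr (Or.inl h)
  · exact Or.inr (Or.inr (Or.inl h))
  · exact Or.inr (Or.inr (Or.inr (Or.inl h)))
  · exact Or.inr (Or.inr (Or.inr (Or.inr (Or.inr (Or.inl h)))))
  · exact Or.inr (Or.inr (Or.inr (Or.inr (Or.inr (Or.inr (Or.inl h))))))
  · exact Or.inr (Or.inr (Or.inr (Or.inr (Or.inr (Or.inr (Or.inr h))))))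

/-- ★ v9 closes `AntiEscapeCore` (eight doors, each a theorem). -/
theorem antiEscapeCore_of_doorAvail9 (hRB : RealCritBoundNSig) (hL : DoorAvailLawQ9) : AntiEscapeCore := by
  intro η f x₀ s hmax R Hs B hE j v hlow hnR hwin hdim hov
  by_cases hz : iteratedDeriv (j + 1) f v = 0
  · exact succ_of_multiple hE hlow.1 hz
  rcases hL η f x₀ s hmax R Hs B hE j v hlow hnR hwin hdim hov hz with hN | hNc | hC | hU | hLd | hW | hJ2 | hNs
  · exact succ_of_newtonNumbers hE hlow.1 hN
  · exact succ_of_newtonNumbersCol hE hlow.1 hNc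
  · exact succ_of_clusterNumbersJ' hRB hE hlow.1 hnR hC
  · exact succ_of_clusterNumbersU hE hlow.1 hU
  · exact RhW08.LandingDoor.succ_of_landingNumbers hE hlow.1 hLd
  · exact succ_of_cornerWindow hE hlow.1 hnR hW
  · exact succ_of_clusterNumbersJ2 hRB hE hlow.1 hnR hJ2
  · exact succ_of_newtonNumbersSharp hE hlow.1 hNs

theorem restSuccBotQ_of_doorAvail9 (hRB : RealCritBoundNSig) (hL : DoorAvailLawQ9) : RestSuccBotQ :=
  restSuccBotQ_of_pieces dimpleSig_holds (antiEscape_of_core (antiEscapeCore_of_doorAvail9 hRB hL))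

/-- v9 and the RATE residual give the crux decl BY NAME. -/
theorem TiltedLandingLaw421R_of_doorAvail9 (hL : DoorAvailLawQ9) (hR : RestRateBotPQ halfPurse) :
    Summit.RiemannHypothesis.RiemannHypothesis.Theses.EarlyAppointments.TiltedLandingLaw421R :=
  law421Half_of_succ_rate (restSuccBotQ_of_doorAvail9 RhW08.ClusterQM.realCritBoundNSig_holds hL) hR

/-! ## §6 REGIME OBSERVABLES and the typed regime boundaries (director CA440: «which regime boundary does the idea control»)

Two dimensionless numbers of the tracked state `v` (with `y = Im v`, `K = newtonK f j v`):
* the COVER INDEX `ι := y·Im K + ½` — by `newtonChild_mem_disc_iff`, `ι ≤ 0` iff the Newton centre `v − K⁻¹` lies in `v`'s closed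
  Jensen disc; by `pairField_im_pos_iff` only a COVERING pair contributes positively to it;
* the FIELD STRENGTH `κ := ‖K‖·y` — door N's regime clause is `1 < κ`.
Boundaries proved below: (B1) the Jensen clause of N♯ with margin `ρ₀` is EXACTLY `ρ₀ ≤ κ ∧ 2ι ≤ ρ₀² − 2ρ₀κ`; (B2) weak field forces
cover: `κ < ½ → 0 < ι` (so an un-covered state always has `κ ≥ ½`: the weak-field regime of U/L is a sub-regime of COVERED). -/

/-- ι, the cover index. -/
noncomputable def coverIndex (f : ℂ → ℂ) (j : ℕ) (v : ℂ) : ℝ := v.im * (newtonK f j v).im + 1 / 2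

/-- κ, the field strength in units of `1/Im v`. -/
noncomputable def fieldStrength (f : ℂ → ℂ) (j : ℕ) (v : ℂ) : ℝ := ‖newtonK f j v‖ * v.im

/-- Exact size of the Newton displacement seen from the Jensen-disc centre: `‖(v − K⁻¹) − Re v‖²·‖K‖² = y²‖K‖² + (1 + 2y·Im K)`. -/
theorem normSq_newtonCentre_mul (v : ℂ) {K : ℂ} (hK : K ≠ 0) :
    ‖(v - K⁻¹) - (v.re : ℂ)‖ ^ 2 * ‖K‖ ^ 2 = v.im ^ 2 * ‖K‖ ^ 2 + (1 + 2 * v.im * K.im) := by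
  have hn : 0 < Complex.normSq K := Complex.normSq_pos.mpr hK
  have hexpr : (v - K⁻¹) - (v.re : ℂ) = (v.im : ℂ) * I - K⁻¹ := Complex.ext (by simp) (by simp)
  rw [hexpr]
  have hre : ((v.im : ℂ) * I - K⁻¹).re = -(K.re / Complex.normSq K) := by
    simp [Complex.sub_re, Complex.mul_re, Complex.inv_re]
  have him : ((v.im : ℂ) * I - K⁻¹).im = v.im + K.im / Complex.normSq K := by
    simp [Complex.sub_im, Complex.mul_im, Complex.inv_im]
    ring
  have key : Complex.normSq ((v.im : ℂ) * I - K⁻¹) * Complex.normSq K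
      = v.im ^ 2 * Complex.normSq K + (1 + 2 * v.im * K.im) := by
    have hnK : Complex.normSq K = K.re * K.re + K.im * K.im := Complex.normSq_apply K
    rw [Complex.normSq_apply ((v.im : ℂ) * I - K⁻¹), hre, him]
    field_simp
    rw [hnK]; ring
  rw [← Complex.normSq_eq_norm_sq, ← Complex.normSq_eq_norm_sq]
  exact key

/-- (B1) THE N♯ ⁄ GRAZING BOUNDARY, exactly: the Jensen clause of `NewtonNumbersSharpWith` with margin `ρ₀/‖K‖` holds iff
`ρ₀ ≤ κ` and `2ι ≤ ρ₀² − 2ρ₀κ` (`ι = y·Im K + ½`, `κ = ‖K‖·y`). -/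
theorem jensenClause_iff {v K : ℂ} (hK : K ≠ 0) (ρ₀ : ℝ) :
    ‖(v - K⁻¹) - (v.re : ℂ)‖ + ρ₀ / ‖K‖ ≤ v.im ↔
      ρ₀ ≤ ‖K‖ * v.im ∧ 1 + 2 * v.im * K.im ≤ ρ₀ ^ 2 - 2 * ρ₀ * (‖K‖ * v.im) := by
  have hnK : 0 < ‖K‖ := norm_pos_iff.mpr hK
  have key := normSq_newtonCentre_mul v hK
  set A := ‖(v - K⁻¹) - (v.re : ℂ)‖ with hA
  have hA0 : 0 ≤ A := norm_nonneg _
  constructor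
  · intro h
    have h1 : ρ₀ ≤ ‖K‖ * v.im := by
      have : ρ₀ / ‖K‖ ≤ v.im := by linarith
      rwa [div_le_iff₀ hnK, mul_comm] at this
    refine ⟨h1, ?_⟩
    have h2 : A * ‖K‖ ≤ ‖K‖ * v.im - ρ₀ := by
      have : A ≤ v.im - ρ₀ / ‖K‖ := by linarith
      have := mul_le_mul_of_nonneg_right this hnK.le
      rwa [sub_mul, div_mul_cancel₀ _ hnK.ne', mul_comm v.im] at this
    have h3 : (A * ‖K‖) ^ 2 ≤ (‖K‖ * v.im - ρ₀) ^ 2 :=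
      pow_le_pow_left₀ (mul_nonneg hA0 hnK.le) h2 2
    nlinarith [key, h3]
  · rintro ⟨h1, h2⟩
    have h3 : (A * ‖K‖) ^ 2 ≤ (‖K‖ * v.im - ρ₀) ^ 2 := by nlinarith [key]
    have h4 : A * ‖K‖ ≤ ‖K‖ * v.im - ρ₀ := by
      have hb : 0 ≤ ‖K‖ * v.im - ρ₀ := by linarith
      exact (pow_le_pow_iff_left₀ (mul_nonneg hA0 hnK.le) hb two_ne_zero).mp h3
    have h5 : ρ₀ / ‖K‖ ≤ v.im - A := by
      rw [div_le_iff₀ hnK]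
      nlinarith
    linarith

/-- (B1′) the same boundary in the observables `ι = coverIndex`, `κ = fieldStrength`, for `K = newtonK f j v`. -/
theorem jensenClause_iff_coverIndex {f : ℂ → ℂ} {j : ℕ} {v : ℂ} (hK : newtonK f j v ≠ 0) (ρ₀ : ℝ) :
    ‖(v - (newtonK f j v)⁻¹) - (v.re : ℂ)‖ + ρ₀ / ‖newtonK f j v‖ ≤ v.im ↔
      ρ₀ ≤ fieldStrength f j v ∧ 2 * coverIndex f j v ≤ ρ₀ ^ 2 - 2 * ρ₀ * fieldStrength f j v := by
  rw [jensenClause_iff hK ρ₀]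
  unfold fieldStrength coverIndex
  constructor <;> rintro ⟨h1, h2⟩ <;> exact ⟨h1, by linarith⟩

/-- (B2) WEAK FIELD FORCES COVER: `κ < ½ → 0 < ι` (`|Im K| ≤ ‖K‖`).  Contrapositive: an un-covered state (`ι ≤ 0`) has `κ ≥ ½`. -/
theorem coverIndex_pos_of_weak {f : ℂ → ℂ} {j : ℕ} {v : ℂ} (hv : 0 < v.im) (hκ : fieldStrength f j v < 1 / 2) :
    0 < coverIndex f j v := by
  unfold fieldStrength at hκ
  unfold coverIndex
  have h1 : |(newtonK f j v).im| ≤ ‖newtonK f j v‖ := Complex.abs_im_le_norm _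
  have h2 : -(‖newtonK f j v‖ * v.im) ≤ v.im * (newtonK f j v).im := by
    have := neg_abs_le (newtonK f j v).im
    nlinarith
  linarith

theorem half_le_fieldStrength_of_uncovered {f : ℂ → ℂ} {j : ℕ} {v : ℂ} (hv : 0 < v.im) (hι : coverIndex f j v ≤ 0) :
    1 / 2 ≤ fieldStrength f j v := by
  by_contra h
  push Not at h
  exact absurd hι (not_le.mpr (coverIndex_pos_of_weak hv h))

/-- (B3) door N♯'s AVAILABILITY REGION in the coordinates `(ι, κ)` — `ρ₀ ≤ κ`, `2ι ≤ ρ₀² − 2ρ₀κ` (Jensen margin, (B1)),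
`ρ₀κ ≤ κ² + ι − ½` (off-axis clause N3: the child's height is `y(κ² + ι − ½)/κ²`) — plus the two zero-configuration clauses
(separation, END number) verbatim.  PROVED repackaging: these five give `NewtonNumbersSharp`, hence a successor. -/
theorem newtonNumbersSharp_of_coordinates {f : ℂ → ℂ} {j : ℕ} {v : ℂ} (hv : 0 < v.im) (hK0 : newtonK f j v ≠ 0)
    {ρ₀ δ : ℝ} (hρ₀ : 0 < ρ₀) (hδ : 0 < δ)
    (hρκ : ρ₀ ≤ fieldStrength f j v)
    (hmargin : 2 * coverIndex f j v ≤ ρ₀ ^ 2 - 2 * ρ₀ * fieldStrength f j v)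
    (hoff : ρ₀ * fieldStrength f j v ≤ fieldStrength f j v ^ 2 + coverIndex f j v - 1 / 2)
    (hsep : ∀ c, dslope (iteratedDeriv j f) v c = 0 → (1 + ρ₀) / ‖newtonK f j v‖ + δ ≤ ‖v - c‖)
    (hend : (1 + ρ₀) * ((1 + ρ₀) / ‖newtonK f j v‖ *
        ∑' c, (analyticOrderNatAt (dslope (iteratedDeriv j f) v) c : ℝ) / ((‖v - c‖ - (1 + ρ₀) / ‖newtonK f j v‖) * ‖v - c‖))
        < ρ₀ * ‖newtonK f j v‖) :
    NewtonNumbersSharp f j v := by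
  have hnK : 0 < ‖newtonK f j v‖ := norm_pos_iff.mpr hK0
  refine ⟨ρ₀, δ, hK0, hρ₀, ?_, hδ, hsep, hend, (jensenClause_iff_coverIndex hK0 ρ₀).mpr ⟨hρκ, hmargin⟩⟩
  have him : (v - (newtonK f j v)⁻¹).im = v.im + (newtonK f j v).im / ‖newtonK f j v‖ ^ 2 := by
    rw [Complex.sub_im, Complex.inv_im, Complex.normSq_eq_norm_sq]; ring
  unfold fieldStrength coverIndex at hoff
  have hKy : 0 < ‖newtonK f j v‖ * v.im := mul_pos hnK hv
  have h2 : ρ₀ ≤ ‖newtonK f j v‖ * v.im + (newtonK f j v).im / ‖newtonK f j v‖ := by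
    have h3 : ρ₀ * (‖newtonK f j v‖ * v.im)
        ≤ (‖newtonK f j v‖ * v.im + (newtonK f j v).im / ‖newtonK f j v‖) * (‖newtonK f j v‖ * v.im) := by
      have : (‖newtonK f j v‖ * v.im + (newtonK f j v).im / ‖newtonK f j v‖) * (‖newtonK f j v‖ * v.im)
          = (‖newtonK f j v‖ * v.im) ^ 2 + v.im * (newtonK f j v).im := by
        field_simp
      rw [this]; linarith
    exact le_of_mul_le_mul_right h3 hKy
  have h1 : ρ₀ / ‖newtonK f j v‖ ≤ v.im + (newtonK f j v).im / ‖newtonK f j v‖ ^ 2 := by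
    rw [div_le_iff₀ hnK]
    have : (v.im + (newtonK f j v).im / ‖newtonK f j v‖ ^ 2) * ‖newtonK f j v‖
        = ‖newtonK f j v‖ * v.im + (newtonK f j v).im / ‖newtonK f j v‖ := by
      field_simp
    rw [this]; exact h2
  rw [him]
  exact h1.trans (le_abs_self _)

/-- (B4) the CHILD'S HEIGHT in coordinates: `Im(v − K⁻¹) = y·(κ² + ι − ½)/κ²` — it vanishes on the LANDING CURVE `ι = ½ − κ²`
(door L's territory) and equals `−y` at the ISOLATED-PAIR corner `(κ, ι) = (½, 0)` (no external field: the child is the mirror). -/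
theorem newtonChild_im {f : ℂ → ℂ} {j : ℕ} {v : ℂ} (hv : 0 < v.im) (hK0 : newtonK f j v ≠ 0) :
    (v - (newtonK f j v)⁻¹).im * fieldStrength f j v ^ 2
      = v.im * (fieldStrength f j v ^ 2 + coverIndex f j v - 1 / 2) := by
  have hnK : 0 < ‖newtonK f j v‖ := norm_pos_iff.mpr hK0
  unfold fieldStrength coverIndex
  rw [Complex.sub_im, Complex.inv_im, Complex.normSq_eq_norm_sq]
  field_simp
  ring

/-! ## §7 DOOR N♭ — the band slack CHARGED AT THE CHILD with its SIGNED height (the cheapest cash-out of the sign reading)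

Door N's scalar slack N5 charges the height at `Im v + (1+ρ₀)/‖K‖` — the sign of the vertical displacement `Im K/‖K‖²` is thrown
away.  N♭ keeps N's engine and N's frame but charges the band inequality at the Newton disc's worst corner:
`(max (|Re(v − K⁻¹) − x₀| + ρ₀/‖K‖ − R/2) 0)² + (j+1)·(|Im(v − K⁻¹)| + ρ₀/‖K‖)² ≤ (j+1)·Hs²`.
For an un-covered state (`ι ≤ 0`) the child is LOWER than `v` by `y(½ − ι)/κ²` ((B4)), so at the strip top (C6's R0 cells, `Im v = Hs`,
where N5 is infeasible for every ρ₀ and N♯'s window is `ρ₀ ≤ |ι|/κ ≈ 0.05–0.11`, instr-1 PRICE-lens1-v1) N♭'s window is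
`h₀ ≲ ρ₀ ≤ (½ − ι)/κ` (≈ 0.2 on those rows) — prediction K-A♭ below. -/

/-- FRAME socket for N♭: N♯'s first six clauses verbatim, the seventh = band slack at the child's worst corner. -/
def NewtonNumbersChildWith (f : ℂ → ℂ) (x₀ R Hs : ℝ) (j : ℕ) (v K : ℂ) (ρ₀ δ : ℝ) : Prop :=
  K ≠ 0 ∧ 0 < ρ₀ ∧ ρ₀ / ‖K‖ ≤ |(v - K⁻¹).im| ∧ 0 < δ ∧
  (∀ c : ℂ, dslope (iteratedDeriv j f) v c = 0 → (1 + ρ₀) / ‖K‖ + δ ≤ ‖v - c‖) ∧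
  (1 + ρ₀) * ((1 + ρ₀) / ‖K‖ *
      ∑' c : ℂ, (analyticOrderNatAt (dslope (iteratedDeriv j f) v) c : ℝ) / ((‖v - c‖ - (1 + ρ₀) / ‖K‖) * ‖v - c‖))
    < ρ₀ * ‖K‖ ∧
  (max (|(v - K⁻¹).re - x₀| + ρ₀ / ‖K‖ - R / 2) 0) ^ 2 + ((j : ℝ) + 1) * (|(v - K⁻¹).im| + ρ₀ / ‖K‖) ^ 2
    ≤ ((j : ℝ) + 1) * Hs ^ 2

/-- DOOR N♭'s numbers at `(j, v)`: some `(ρ₀, δ)` with `K = newtonK f j v`. -/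
def NewtonNumbersChild (f : ℂ → ℂ) (x₀ R Hs : ℝ) (j : ℕ) (v : ℂ) : Prop :=
  ∃ ρ₀ δ : ℝ, NewtonNumbersChildWith f x₀ R Hs j v (newtonK f j v) ρ₀ δ

/-- The child-charged corner slack gives the whole-disc band clause (monotonicity of the band inequality in `|Re z − x₀|`, `|Im z|`). -/
theorem hdisc_of_childSlack {x₀ R Hs : ℝ} {j : ℕ} {c₀ : ℂ} {r : ℝ}
    (hS : (max (|c₀.re - x₀| + r - R / 2) 0) ^ 2 + ((j : ℝ) + 1) * (|c₀.im| + r) ^ 2 ≤ ((j : ℝ) + 1) * Hs ^ 2) :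
    ∀ z : ℂ, ‖z - c₀‖ < r → |z.im| ≤ Hs →
      (max (|z.re - x₀| - R / 2) 0) ^ 2 + ((j : ℝ) + 1) * z.im ^ 2 ≤ ((j : ℝ) + 1) * Hs ^ 2 := by
  intro z hz _
  have hre : |(z - c₀).re| ≤ ‖z - c₀‖ := Complex.abs_re_le_norm _
  have him : |(z - c₀).im| ≤ ‖z - c₀‖ := Complex.abs_im_le_norm _
  rw [Complex.sub_re] at hre
  rw [Complex.sub_im] at him
  have h1 : |z.re - x₀| ≤ |c₀.re - x₀| + r := by
    have h' : |z.re - c₀.re| ≤ r := by linarith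
    calc |z.re - x₀| = |(z.re - c₀.re) + (c₀.re - x₀)| := by ring_nf
      _ ≤ |z.re - c₀.re| + |c₀.re - x₀| := abs_add_le _ _
      _ ≤ |c₀.re - x₀| + r := by linarith
  have h2 : |z.im| ≤ |c₀.im| + r := by
    calc |z.im| = |(z.im - c₀.im) + c₀.im| := by ring_nf
      _ ≤ |z.im - c₀.im| + |c₀.im| := abs_add_le _ _
      _ ≤ |c₀.im| + r := by linarith
  have hA : max (|z.re - x₀| - R / 2) 0 ≤ max (|c₀.re - x₀| + r - R / 2) 0 :=
    max_le_max (by linarith) le_rfl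
  have hA0 : 0 ≤ max (|z.re - x₀| - R / 2) 0 := le_max_right _ _
  have hA2 : (max (|z.re - x₀| - R / 2) 0) ^ 2 ≤ (max (|c₀.re - x₀| + r - R / 2) 0) ^ 2 := pow_le_pow_left₀ hA0 hA 2
  have hB2 : z.im ^ 2 ≤ (|c₀.im| + r) ^ 2 := by
    calc z.im ^ 2 = |z.im| ^ 2 := (sq_abs _).symm
      _ ≤ (|c₀.im| + r) ^ 2 := pow_le_pow_left₀ (abs_nonneg _) h2 2
  have hj : (0 : ℝ) ≤ (j : ℝ) + 1 := by positivity
  nlinarith [mul_le_mul_of_nonneg_left hB2 hj]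

/-- ★★ DOOR N♭: a legal frame, a band state `v`, and child-charged Newton numbers ⇒ the successor state.  No `1 < ‖K‖·Im v`. -/
theorem succ_of_newtonNumbersChild {η : ℝ} {f : ℂ → ℂ} {x₀ s hmax R Hs : ℝ} {B j : ℕ} {v : ℂ}
    (hE : EngineHyps5 2 η f x₀ s hmax R Hs B) (hv : StTrkDQ η f x₀ s hmax R Hs B j v) (hN : NewtonNumbersChild f x₀ R Hs j v) :
    ∃ u : ℂ, StTrkDQ η f x₀ s hmax R Hs B (j + 1) u := by
  by_cases hz : iteratedDeriv (j + 1) f v = 0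
  · exact succ_of_multiple hE hv hz
  obtain ⟨ρ₀, δ, hK, hρ₀, hoff, hδ, hsepZ, hendZ, hS⟩ := hN
  have hf : Summit.RiemannHypothesis.RiemannHypothesis.Theorems.Splittings.JensenWindow.RealEntireLt2 f :=
    realEntireLt2_of_hyps hE
  obtain ⟨ρ, C, hρ0, hρ, hgr⟩ := hf.growth
  obtain ⟨ρ', C', -, hρ', hgr'⟩ := Literature.Analysis.Complex.exists_growth_iteratedDeriv hf.diff hρ0 hρ hgr j
  have hFd : Differentiable ℂ (iteratedDeriv j f) := differentiable_iteratedDeriv_of_entire hE.1 j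
  have hv' : StColQ' η f x₀ s hmax R Hs B j v := hv
  obtain ⟨-, hFv, -⟩ := hv'
  have hderiv : deriv (iteratedDeriv j f) v ≠ 0 := by
    rw [← iteratedDeriv_succ]; exact hz
  have hsimple : analyticOrderAt (iteratedDeriv j f) v = 1 :=
    (hFd.analyticAt v).analyticOrderAt_eq_one_of_zero_deriv_ne_zero hFv hderiv
  exact succ_of_newton_door_genusOne_disc hE hv hFd hgr' hρ' hFv hsimple rfl hK hρ₀ hoff hδ hsepZ hendZ
    (hdisc_of_childSlack hS)

/-- (B6) N♭'s HEIGHT clause in coordinates for an un-covered-below-the-axis-safe state: when the child is in the upper half-plane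
(`κ² + ι − ½ ≥ 0`), `|Im(v − K⁻¹)| + ρ₀/‖K‖ ≤ Hs` iff `y·(κ² + ι − ½) + ρ₀·y·κ ≤ Hs·κ²` — at the strip top `y = Hs` this is
`ρ₀ ≤ (½ − ι)/κ`, against N♯'s `ρ₀ ≲ |ι|/κ` and N5's `∅`. -/
theorem childHeight_le_iff {f : ℂ → ℂ} {j : ℕ} {v : ℂ} (hv : 0 < v.im) (hK0 : newtonK f j v ≠ 0) {ρ₀ Hs : ℝ}
    (hup : 0 ≤ fieldStrength f j v ^ 2 + coverIndex f j v - 1 / 2) :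
    |(v - (newtonK f j v)⁻¹).im| + ρ₀ / ‖newtonK f j v‖ ≤ Hs ↔
      v.im * (fieldStrength f j v ^ 2 + coverIndex f j v - 1 / 2) + ρ₀ * v.im * fieldStrength f j v
        ≤ Hs * fieldStrength f j v ^ 2 := by
  have hnK : 0 < ‖newtonK f j v‖ := norm_pos_iff.mpr hK0
  have hκ : 0 < fieldStrength f j v := by unfold fieldStrength; positivity
  have hh := newtonChild_im hv hK0   -- Im(child)·κ² = y·(κ²+ι−½)
  have hκ2 : 0 < fieldStrength f j v ^ 2 := by positivity
  have him0 : 0 ≤ (v - (newtonK f j v)⁻¹).im := by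
    by_contra hc
    push Not at hc
    have h1 : (v - (newtonK f j v)⁻¹).im * fieldStrength f j v ^ 2 < 0 := mul_neg_of_neg_of_pos hc hκ2
    rw [hh] at h1
    have h2 : 0 ≤ v.im * (fieldStrength f j v ^ 2 + coverIndex f j v - 1 / 2) := mul_nonneg hv.le hup
    linarith
  rw [abs_of_nonneg him0]
  have hρ : ρ₀ / ‖newtonK f j v‖ * fieldStrength f j v ^ 2 = ρ₀ * v.im * fieldStrength f j v := by
    unfold fieldStrength
    field_simp
  have key : ((v - (newtonK f j v)⁻¹).im + ρ₀ / ‖newtonK f j v‖) * fieldStrength f j v ^ 2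
      = v.im * (fieldStrength f j v ^ 2 + coverIndex f j v - 1 / 2) + ρ₀ * v.im * fieldStrength f j v := by
    rw [add_mul, hh, hρ]
  constructor
  · intro h
    have := mul_le_mul_of_nonneg_right h hκ2.le
    rw [key] at this
    exact this
  · intro h
    rw [← key] at h
    exact le_of_mul_le_mul_right h hκ2

/-- v10 CANDIDATE text = v8-of-record ∨ J2 ∨ N♯ ∨ N♭ (everything lens-1 proposes under ONE law; door-integration rule CA441 decides). -/
def DoorAvailLawQ10 : Prop :=
  ∀ (η : ℝ) (f : ℂ → ℂ) (x₀ s hmax R Hs : ℝ) (B : ℕ), EngineHyps5 2 η f x₀ s hmax R Hs B → ∀ (j : ℕ) (v : ℂ),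
    IsLowest StTrkDQ η f x₀ s hmax R Hs B j v → ¬ ReadyR2 η f x₀ s hmax R Hs B j v →
    ¬ AllInBandInRangeWindow f x₀ R Hs j v → ¬ Dimple f j v → DiscOverlap f j v →
    iteratedDeriv (j + 1) f v ≠ 0 →
    NewtonNumbers f x₀ R Hs j v ∨ NewtonNumbersCol f x₀ R Hs j ∨ ClusterNumbersJ' f x₀ R Hs j ∨ ClusterNumbersU f x₀ R j ∨
      RhW08.LandingDoor.LandingNumbers f x₀ R Hs j ∨ CornerWindow f x₀ R Hs j ∨ ClusterNumbersJ2 f x₀ R Hs j ∨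
      NewtonNumbersSharp f j v ∨ NewtonNumbersChild f x₀ R Hs j v

theorem doorAvail10_of_doorAvail9 (hL : DoorAvailLawQ9) : DoorAvailLawQ10 := by
  intro η f x₀ s hmax R Hs B hE j v hlow hnR hwin hdim hov hz
  rcases hL η f x₀ s hmax R Hs B hE j v hlow hnR hwin hdim hov hz with h | h | h | h | h | h | h | h
  · exact Or.inl h
  · exact Or.inr (Or.inl h)
  · exact Or.inr (Or.inr (Or.inl h))
  · exact Or.inr (Or.inr (Or.inr (Or.inl h)))
  · exact Or.inr (Or.inr (Or.inr (Or.inr (Or.inl h))))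
  · exact Or.inr (Or.inr (Or.inr (Or.inr (Or.inr (Or.inl h)))))
  · exact Or.inr (Or.inr (Or.inr (Or.inr (Or.inr (Or.inr (Or.inl h))))))
  · exact Or.inr (Or.inr (Or.inr (Or.inr (Or.inr (Or.inr (Or.inr (Or.inl h)))))))

theorem doorAvail10_of_doorAvail8 (hL : RhW08.LandingDoor.DoorAvailLawQ8) : DoorAvailLawQ10 :=
  doorAvail10_of_doorAvail9 (doorAvail9_of_doorAvail8 hL)

/-- ★ v10 closes `AntiEscapeCore` (nine doors, each a theorem) and hence the crux decl BY NAME. -/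
theorem antiEscapeCore_of_doorAvail10 (hRB : RealCritBoundNSig) (hL : DoorAvailLawQ10) : AntiEscapeCore := by
  intro η f x₀ s hmax R Hs B hE j v hlow hnR hwin hdim hov
  by_cases hz : iteratedDeriv (j + 1) f v = 0
  · exact succ_of_multiple hE hlow.1 hz
  rcases hL η f x₀ s hmax R Hs B hE j v hlow hnR hwin hdim hov hz with hN | hNc | hC | hU | hLd | hW | hJ2 | hNs | hNb
  · exact succ_of_newtonNumbers hE hlow.1 hN
  · exact succ_of_newtonNumbersCol hE hlow.1 hNc
  · exact succ_of_clusterNumbersJ' hRB hE hlow.1 hnR hC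
  · exact succ_of_clusterNumbersU hE hlow.1 hU
  · exact RhW08.LandingDoor.succ_of_landingNumbers hE hlow.1 hLd
  · exact succ_of_cornerWindow hE hlow.1 hnR hW
  · exact succ_of_clusterNumbersJ2 hRB hE hlow.1 hnR hJ2
  · exact succ_of_newtonNumbersSharp hE hlow.1 hNs
  · exact succ_of_newtonNumbersChild hE hlow.1 hNb

theorem TiltedLandingLaw421R_of_doorAvail10 (hL : DoorAvailLawQ10) (hR : RestRateBotPQ halfPurse) :
    Summit.RiemannHypothesis.RiemannHypothesis.Theses.EarlyAppointments.TiltedLandingLaw421R :=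
  law421Half_of_succ_rate
    (restSuccBotQ_of_pieces dimpleSig_holds (antiEscape_of_core (antiEscapeCore_of_doorAvail10 RhW08.ClusterQM.realCritBoundNSig_holds hL))) hR

/-! ## §8 (E1) the END number under SEPARATION: far zeros ⇒ the END sum is at most `2·S₂` ⇒ piece F with honest constants

With `g := dslope (f^{(j)}) v` (zeros = the other zeros of `f^{(j)}`, multiplicity `ord`), `r := (1+ρ₀)/‖K‖`: if every zero `c` of `g` has
`‖v − c‖ ≥ 2r` then `Σ' ord(c)/((‖v−c‖ − r)‖v−c‖) ≤ 2·Σ' ord(c)/‖v−c‖² =: 2S₂`, so END holds as soon as `2(1+ρ₀)²·S₂ < ρ₀‖K‖²`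
(in coordinates: `2(1+ρ₀)²·S₂y² < ρ₀κ²`).  Together with (B3): UN-COVERED-with-margin ∧ FAR ∧ LIGHT ⇒ N♯ ⇒ successor — PROVED. -/

theorem analyticOrderNatAt_eq_zero_of_ne {g : ℂ → ℂ} (hg : Differentiable ℂ g) {c : ℂ} (hc : g c ≠ 0) :
    analyticOrderNatAt g c = 0 := by
  have ha : AnalyticAt ℂ g c := hg.analyticAt c
  unfold analyticOrderNatAt
  rw [ha.analyticOrderAt_eq_zero.mpr hc]
  rfl

/-- (E1) termwise-to-sum: separation `2r` turns the END sum into `≤ 2·S₂`. -/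
theorem endSum_le_two_S2 {g : ℂ → ℂ} (hg : Differentiable ℂ g) {v : ℂ} {r : ℝ} (hr : 0 < r)
    (hsep : ∀ c : ℂ, g c = 0 → 2 * r ≤ ‖v - c‖)
    (hS : Summable (fun c : ℂ => (analyticOrderNatAt g c : ℝ) / ‖v - c‖ ^ 2)) :
    ∑' c : ℂ, (analyticOrderNatAt g c : ℝ) / ((‖v - c‖ - r) * ‖v - c‖)
      ≤ 2 * ∑' c : ℂ, (analyticOrderNatAt g c : ℝ) / ‖v - c‖ ^ 2 := by
  have hterm : ∀ c : ℂ, (analyticOrderNatAt g c : ℝ) / ((‖v - c‖ - r) * ‖v - c‖)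
      ≤ 2 * ((analyticOrderNatAt g c : ℝ) / ‖v - c‖ ^ 2) := by
    intro c
    by_cases hc : g c = 0
    · have hd : 2 * r ≤ ‖v - c‖ := hsep c hc
      have hd0 : 0 < ‖v - c‖ := by linarith
      have hdr : ‖v - c‖ / 2 ≤ ‖v - c‖ - r := by linarith
      have hdr0 : 0 < ‖v - c‖ - r := by linarith
      have hn : (0 : ℝ) ≤ (analyticOrderNatAt g c : ℝ) := by positivity
      rw [div_le_iff₀ (mul_pos hdr0 hd0)]
      have : 2 * ((analyticOrderNatAt g c : ℝ) / ‖v - c‖ ^ 2) * ((‖v - c‖ - r) * ‖v - c‖)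
          = (analyticOrderNatAt g c : ℝ) * (2 * (‖v - c‖ - r) / ‖v - c‖) := by
        field_simp
      rw [this]
      have h2 : 1 ≤ 2 * (‖v - c‖ - r) / ‖v - c‖ := by
        rw [le_div_iff₀ hd0]; linarith
      nlinarith
    · rw [analyticOrderNatAt_eq_zero_of_ne hg hc]
      simp
  have hnn : ∀ c : ℂ, 0 ≤ (analyticOrderNatAt g c : ℝ) / ((‖v - c‖ - r) * ‖v - c‖) := by
    intro c
    by_cases hc : g c = 0
    · have hd : 2 * r ≤ ‖v - c‖ := hsep c hc
      have hdr0 : 0 < ‖v - c‖ - r := by linarith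
      have hd0 : 0 < ‖v - c‖ := by linarith
      positivity
    · rw [analyticOrderNatAt_eq_zero_of_ne hg hc]
      simp
  have hS2 : Summable (fun c : ℂ => 2 * ((analyticOrderNatAt g c : ℝ) / ‖v - c‖ ^ 2)) := hS.mul_left 2
  have hS1 : Summable (fun c : ℂ => (analyticOrderNatAt g c : ℝ) / ((‖v - c‖ - r) * ‖v - c‖)) :=
    Summable.of_nonneg_of_le hnn hterm hS2
  calc ∑' c : ℂ, (analyticOrderNatAt g c : ℝ) / ((‖v - c‖ - r) * ‖v - c‖)
      ≤ ∑' c : ℂ, 2 * ((analyticOrderNatAt g c : ℝ) / ‖v - c‖ ^ 2) := hS1.tsum_le_tsum hterm hS2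
    _ = 2 * ∑' c : ℂ, (analyticOrderNatAt g c : ℝ) / ‖v - c‖ ^ 2 := tsum_mul_left

/-- ★ (B3+E1) PIECE F PROVED: an un-covered state with Jensen margin `ρ₀`, off-axis room, every other zero at distance
`≥ 2(1+ρ₀)/‖K‖ + δ`, and LIGHT far field `2(1+ρ₀)²·S₂ < ρ₀‖K‖²` has Newton numbers♯, hence a successor. -/
theorem newtonNumbersSharp_of_far {f : ℂ → ℂ} (hf : Differentiable ℂ f) {j : ℕ} {v : ℂ} (hv : 0 < v.im)
    (hK0 : newtonK f j v ≠ 0) {ρ₀ δ : ℝ} (hρ₀ : 0 < ρ₀) (hδ : 0 < δ)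
    (hρκ : ρ₀ ≤ fieldStrength f j v)
    (hmargin : 2 * coverIndex f j v ≤ ρ₀ ^ 2 - 2 * ρ₀ * fieldStrength f j v)
    (hoff : ρ₀ * fieldStrength f j v ≤ fieldStrength f j v ^ 2 + coverIndex f j v - 1 / 2)
    (hsep2 : ∀ c, dslope (iteratedDeriv j f) v c = 0 → 2 * ((1 + ρ₀) / ‖newtonK f j v‖) + δ ≤ ‖v - c‖)
    (hS : Summable (fun c : ℂ => (analyticOrderNatAt (dslope (iteratedDeriv j f) v) c : ℝ) / ‖v - c‖ ^ 2))
    (hlight : 2 * (1 + ρ₀) ^ 2 * ∑' c : ℂ, (analyticOrderNatAt (dslope (iteratedDeriv j f) v) c : ℝ) / ‖v - c‖ ^ 2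
        < ρ₀ * ‖newtonK f j v‖ ^ 2) :
    NewtonNumbersSharp f j v := by
  have hnK : 0 < ‖newtonK f j v‖ := norm_pos_iff.mpr hK0
  have hG : Differentiable ℂ (iteratedDeriv j f) := by
    have := hf.contDiff (n := ⊤)
    exact (this.differentiable_iteratedDeriv j (WithTop.coe_lt_top _))
  have hg : Differentiable ℂ (dslope (iteratedDeriv j f) v) :=
    Literature.NumberTheory.LFunctions.BurnolVectors.differentiable_dslope hG v
  have hr : 0 < (1 + ρ₀) / ‖newtonK f j v‖ := by positivity
  have hsep : ∀ c, dslope (iteratedDeriv j f) v c = 0 → (1 + ρ₀) / ‖newtonK f j v‖ + δ ≤ ‖v - c‖ := by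
    intro c hc
    have := hsep2 c hc
    linarith
  have hsep' : ∀ c, dslope (iteratedDeriv j f) v c = 0 → 2 * ((1 + ρ₀) / ‖newtonK f j v‖) ≤ ‖v - c‖ := by
    intro c hc
    have := hsep2 c hc
    linarith
  have hE1 := endSum_le_two_S2 hg hr hsep' hS
  refine newtonNumbersSharp_of_coordinates hv hK0 hρ₀ hδ hρκ hmargin hoff hsep ?_
  set T := ∑' c : ℂ, (analyticOrderNatAt (dslope (iteratedDeriv j f) v) c : ℝ) /
      ((‖v - c‖ - (1 + ρ₀) / ‖newtonK f j v‖) * ‖v - c‖) with hT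
  set S₂ := ∑' c : ℂ, (analyticOrderNatAt (dslope (iteratedDeriv j f) v) c : ℝ) / ‖v - c‖ ^ 2 with hS₂
  have h1 : (1 + ρ₀) * ((1 + ρ₀) / ‖newtonK f j v‖ * T) ≤ (1 + ρ₀) * ((1 + ρ₀) / ‖newtonK f j v‖ * (2 * S₂)) := by
    have h1ρ : 0 ≤ 1 + ρ₀ := by linarith
    exact mul_le_mul_of_nonneg_left (mul_le_mul_of_nonneg_left hE1 hr.le) h1ρ
  have h2 : (1 + ρ₀) * ((1 + ρ₀) / ‖newtonK f j v‖ * (2 * S₂)) < ρ₀ * ‖newtonK f j v‖ := by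
    rw [show (1 + ρ₀) * ((1 + ρ₀) / ‖newtonK f j v‖ * (2 * S₂)) = (2 * (1 + ρ₀) ^ 2 * S₂) / ‖newtonK f j v‖ by
      field_simp]
    rw [div_lt_iff₀ hnK]
    nlinarith [hlight]
  exact lt_of_le_of_lt h1 h2

/-! ## §9 PIECE R (ROOF LOCALISATION) modulo ONE typed analytic input — the SIGN IDENTITY (S1)

(S1) says: the zeros of `F = f^{(j)}` other than `v, v̄` can be listed (with multiplicity, conjugation-closed) so that
`2·Im K_ext(v) = Σ_i pairTerm v (a i)`, i.e. `2ι = y·Σ_i pairTerm v (a i)`.  DERIVATION for C1 (no Hadamard constant, no limits):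
put `g := F/((z − v)(z − v̄))` — REAL entire of the same growth, `g(v) = F′(v)/(v − v̄) ≠ 0`, `g′/g(v) = K − 1/(v − v̄) = K + i/(2y) = K_ext`,
`g′/g(v̄) = conj(K_ext)` (reality); the genus-one TWO-POINT identity (`…GenusOneLogDerivC3g41.logDeriv_sub_logDeriv_eq_tsum_zeros`, for the
translate of `g`) between `v` and `v̄` gives `2i·Im K_ext = Σ_c [1/(v−c) − 1/(v̄−c)]`; re-indexing the conjugation-closed list,
`Σ_c Im 1/(v̄ − c) = −Σ_c Im 1/(v − c)`, whence `2·Im K_ext = Σ_c pairTerm v c`.  Below: GIVEN (S1), the cover criterion (R1) and the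
quantitative localisation (R3) are PROVED, with the exact constant: `2ι·d₁ ≤ y·#(covering zeros listed)`, i.e. `ι·d₁ ≤ m·y` for `m` covering pairs. -/

/-- The PAIR TERM of the signed potential: `Im[(v − c)⁻¹ + (v − c̄)⁻¹]` (symmetric in `c ↔ c̄`). -/
noncomputable def pairTerm (v c : ℂ) : ℝ := ((v - c)⁻¹ + (v - conj c)⁻¹).im

theorem pairTerm_conj (v c : ℂ) : pairTerm v (conj c) = pairTerm v c := by
  unfold pairTerm
  rw [Complex.conj_conj, add_comm]

/-- (S1) THE SIGN IDENTITY — typed analytic input (IDEA-NEEDED → C1; derivation in the section docstring). -/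
def CoverIndexPairSum (f : ℂ → ℂ) (j : ℕ) (v : ℂ) : Prop :=
  ∃ (I : Type) (a : I → ℂ), (∀ i, iteratedDeriv j f (a i) = 0 ∧ a i ≠ v ∧ a i ≠ conj v) ∧
    Summable (fun i => pairTerm v (a i)) ∧ 2 * coverIndex f j v = v.im * ∑' i, pairTerm v (a i)

/-- (R1) COVER CRITERION (given S1): a positive cover index forces a COVERING zero pair of `f^{(j)}`. -/
theorem exists_cover_of_coverIndex_pos {f : ℂ → ℂ} {j : ℕ} {v : ℂ} (hS : CoverIndexPairSum f j v) (hv : 0 < v.im)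
    (hι : 0 < coverIndex f j v) :
    ∃ c : ℂ, iteratedDeriv j f c = 0 ∧ c ≠ v ∧ c ≠ conj v ∧ (v.re - c.re) ^ 2 + v.im ^ 2 < c.im ^ 2 := by
  obtain ⟨I, a, ha, hsum, hid⟩ := hS
  by_contra hno
  push Not at hno
  have hle : ∀ i, pairTerm v (a i) ≤ 0 := by
    intro i
    obtain ⟨h0, h1, h2⟩ := ha i
    have hc := hno (a i) h0 h1 h2
    by_contra hp
    push Not at hp
    have := (pairField_im_pos_iff hv h1 h2).mp hp
    linarith
  have h1 : ∑' i, pairTerm v (a i) ≤ 0 := tsum_nonpos hle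
  have h2 : v.im * ∑' i, pairTerm v (a i) ≤ 0 := mul_nonpos_of_nonneg_of_nonpos hv.le h1
  linarith

/-- (R2) the pair term of an upper-half-plane zero is at most `1/‖v − c‖` (pure algebra: the `c̄`-part is negative and
`(Im c − Im v)/‖v − c‖² ≤ 1/‖v − c‖`). -/
theorem pairTerm_le_inv_norm {v c : ℂ} (hv : 0 < v.im) (hc : 0 < c.im) (h1 : c ≠ v) :
    pairTerm v c ≤ 1 / ‖v - c‖ := by
  have hvc : v - c ≠ 0 := sub_ne_zero.mpr (Ne.symm h1)
  have hn1 : 0 < Complex.normSq (v - c) := Complex.normSq_pos.mpr hvc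
  have hvc' : v - conj c ≠ 0 := by
    intro h
    have := congrArg Complex.im h
    simp at this
    linarith
  have hn2 : 0 < Complex.normSq (v - conj c) := Complex.normSq_pos.mpr hvc'
  have hd : 0 < ‖v - c‖ := norm_pos_iff.mpr hvc
  unfold pairTerm
  rw [Complex.add_im, Complex.inv_im, Complex.inv_im]
  have him1 : (v - c).im = v.im - c.im := by simp
  have him2 : (v - conj c).im = v.im + c.im := by simp
  rw [him1, him2]
  have hA : -(v.im + c.im) / Complex.normSq (v - conj c) ≤ 0 :=
    div_nonpos_of_nonpos_of_nonneg (by linarith) hn2.le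
  have hB : -(v.im - c.im) / Complex.normSq (v - c) ≤ 1 / ‖v - c‖ := by
    rw [Complex.normSq_eq_norm_sq, div_le_div_iff₀ (by positivity) hd]
    have habs : |(v - c).im| ≤ ‖v - c‖ := Complex.abs_im_le_norm _
    rw [him1] at habs
    have : -(v.im - c.im) ≤ ‖v - c‖ := by
      have := neg_abs_le (v.im - c.im)
      have := abs_sub_comm v.im c.im
      linarith [le_abs_self (c.im - v.im)]
    nlinarith
  linarith

/-- (R3) ROOF LOCALISATION (given S1's list): if every covering listed zero lies in the finset `S` and each member of `S`
and its conjugate are at distance `≥ d₁` from `v`, then `2ι·d₁ ≤ y·#S` — a positive cover index puts a covering pair within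
`#S·y/(2ι)` of `v` (`#S = 2m` for `m` covering pairs listed with both members). -/
theorem coverIndex_mul_dist_le {f : ℂ → ℂ} {j : ℕ} {v : ℂ} (hv : 0 < v.im) {I : Type} {a : I → ℂ}
    (ha : ∀ i, iteratedDeriv j f (a i) = 0 ∧ a i ≠ v ∧ a i ≠ conj v)
    (hsum : Summable (fun i => pairTerm v (a i))) (hid : 2 * coverIndex f j v = v.im * ∑' i, pairTerm v (a i))
    (S : Finset I) (hcov : ∀ i, (v.re - (a i).re) ^ 2 + v.im ^ 2 < (a i).im ^ 2 → i ∈ S)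
    {d₁ : ℝ} (hd₁ : 0 < d₁) (hd : ∀ i ∈ S, d₁ ≤ ‖v - a i‖ ∧ d₁ ≤ ‖v - conj (a i)‖) :
    2 * coverIndex f j v * d₁ ≤ v.im * S.card := by
  classical
  -- termwise majorant supported on S
  set g : I → ℝ := fun i => if i ∈ S then 1 / d₁ else 0 with hg
  have hPg : ∀ i, pairTerm v (a i) ≤ g i := by
    intro i
    obtain ⟨h0, h1, h2⟩ := ha i
    by_cases hi : i ∈ S
    · simp only [hg, hi, if_true]
      obtain ⟨hda, hdb⟩ := hd i hi
      -- use the upper representative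
      rcases lt_trichotomy 0 (a i).im with hpos | hzero | hneg
      · calc pairTerm v (a i) ≤ 1 / ‖v - a i‖ := pairTerm_le_inv_norm hv hpos h1
          _ ≤ 1 / d₁ := one_div_le_one_div_of_le hd₁ hda
      · -- real zero: pair term ≤ 0
        have hnp : ¬ 0 < pairTerm v (a i) := by
          intro hp
          have := (pairField_im_pos_iff hv h1 h2).mp hp
          rw [← hzero] at this
          nlinarith [sq_nonneg (v.re - (a i).re)]
        push Not at hnp
        exact hnp.trans (by positivity)
      · have hpos' : 0 < (conj (a i)).im := by simp; linarith
        have h1' : conj (a i) ≠ v := by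
          intro h; apply h2; rw [← h, Complex.conj_conj]
        calc pairTerm v (a i) = pairTerm v (conj (a i)) := (pairTerm_conj v (a i)).symm
          _ ≤ 1 / ‖v - conj (a i)‖ := pairTerm_le_inv_norm hv hpos' h1'
          _ ≤ 1 / d₁ := one_div_le_one_div_of_le hd₁ hdb
    · simp only [hg, hi, if_false]
      have hnc : ¬ ((v.re - (a i).re) ^ 2 + v.im ^ 2 < (a i).im ^ 2) := fun h => hi (hcov i h)
      by_contra hp
      push Not at hp
      exact hnc ((pairField_im_pos_iff hv h1 h2).mp hp)
  have hgS : ∀ i ∉ S, g i = 0 := by intro i hi; simp [hg, hi]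
  have hgsum : Summable g := summable_of_ne_finset_zero hgS
  have h1 : ∑' i, pairTerm v (a i) ≤ ∑' i, g i := hsum.tsum_le_tsum hPg hgsum
  have h2 : ∑' i, g i = S.card * (1 / d₁) := by
    rw [tsum_eq_sum (s := S) (fun i hi => hgS i hi)]
    have : ∀ i ∈ S, g i = 1 / d₁ := by intro i hi; simp [hg, hi]
    rw [Finset.sum_congr rfl this, Finset.sum_const, nsmul_eq_mul]
  have h3 : 2 * coverIndex f j v ≤ v.im * (S.card * (1 / d₁)) := by
    rw [hid, ← h2]; exact mul_le_mul_of_nonneg_left h1 hv.le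
  have h4 : v.im * (S.card * (1 / d₁)) * d₁ = v.im * S.card := by field_simp
  calc 2 * coverIndex f j v * d₁ ≤ v.im * (S.card * (1 / d₁)) * d₁ := mul_le_mul_of_nonneg_right h3 hd₁.le
    _ = v.im * S.card := h4

end Summit.RiemannHypothesis.RiemannHypothesis.Cruxes.TiltedLandingLaw421R.Lens1
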